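import Summits.Langlands.Langlands.Theses.SkinnerWilesDefectOne
import Summits.Langlands.Langlands.Theorems.EisensteinProModularSeed.Negative.OrientedFrame
import Summits.Langlands.Langlands.Theorems.EisensteinProModularSeed.Negative.BorelAndEisenstein

/-!
# Line `descend-raise-basechange` — checked skeleton for the crux
`Summit.Langlands.Langlands.Theses.SkinnerWilesDefectOne.EisensteinProModularSeed` (stmt-Langlands-12920)

Planner crux-plan, round 1 (idea card `Cruxes/EisensteinProModularSeed/Ideas/descend-raise-basechange.md`,
ideator 2; triage `TRIAGE-r1-{1,2,3}.md`: pass ×3, "fold in as the DESCENDED stub (K3) of the merged geometric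
line big-image-cousin ≈ ell-switch-geometric-seed"; line card `Cruxes/EisensteinProModularSeed/Lines/descend-raise-basechange.md`).
Six registered stubs `stub_*` (the only `sorry`s of the file) and the kernel-checked composition

  `EisensteinProModularSeed_of : S.stub_inertBMPrimeSupply → S.stub_levelRaisedEisensteinNewformQ →
     S.stub_restrictTwistGaloisPackage → S.stub_quadraticBaseChangeTwist → S.stub_cuspidalCohomologicalPoint →
     S.stub_complementRegimeSeed → EisensteinProModularSeed`

(pure logic: case split on the regime predicate `InBMRange F p O ρ₀` of §0).

THE CRUX (fixed; route SkinnerWilesDefectOne, rank 3, THE ENTRANCE). `F` imaginary quadratic, `p` odd, `O = 𝒪_{ℚ̄_p}`;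
every irreducible a.e.-unramified `ρ : Γ_F → GL₂(ℚ̄_p)` with a residually upper-triangular integral model `ρ₀` (ordered
residual pair `(χ̄_a, χ̄_b)`), `p`-distinguished and ORIENTED-ordinary of one parallel weight at every `v ∣ p`, has a
partner: a tame level `𝒰`, an IRREDUCIBLE `p`-adically automorphic `r` of level `𝒰` with an integral model `r₀` of the
SAME ordered residual diagonal, oriented-ordinary of some parallel weight, and ONE place `q` such that `𝒰` is hyperspecial
at every `v ≠ q`, `v ∤ p` where both residual characters are unramified.  By the standing disprover
(`Cruxes/EisensteinProModularSeed/Disproof.lean`, cdisprove gen 2, §1 `concl_congr` / `crux_iff_pairSeedArising`) its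
conclusion depends on `ρ₀` only through the ordered residual PAIR, and (§6.1 `seedNoLevel_of_engine`) its whole content
relative to the engine is the ONE-`q` level clause.

THE IDEA (card `descend-raise-basechange`; Disproof §5 "TRUE for pairs descending to ℚ", §7D "(b) GEOMETRIC — base change
of Mazur/Billerey–Menares newforms"). When the residual RATIO `χ̄ := χ̄_b/χ̄_a` extends to a character `η̄` of `Γ_ℚ`
(⟺ `χ̄` is `Gal(F/ℚ)`-invariant; one of the two extensions `η̄, η̄ε_F` is ODD, `ε_F` being odd), the pair is, up to the
twist by `χ̄_a`, the restriction of the odd Eisenstein datum `1 ⊕ η̄` over `ℚ`.  Over `ℚ` the level is raised at ONE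
auxiliary prime `M` by Billerey–Menares (BillereyMenares2018 = arXiv:1604.01173, Thm 2, p. 3 read: for `ℓ > k + 1` an
odd `ρ̄ = ε₁ ⊕ ε₂χ^{k-1}` of Serre type `(N, k, ε)`, not strongly modular, arises from a newform of level `NM`,
`M ∤ Nℓ`, iff `η(M)M^k = 1`, `η = ε₁⁻¹ε₂` — here `ε₁ = 1`, `ε₂ = η̄ω^{-j}` with `η̄|I_p = ω^j`, `k = j + 1`, and the
condition reads `η̄(Frob_M)·M ≡ 1`; Mazur's `M ≡ 1 (mod p)` for `(N, k) = (1, 2)`, i.e. for `η̄ = ω`; if `ρ̄` IS strongly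
modular the level-`N` newform serves and no auxiliary prime is needed) with `M` chosen INERT in `F`, so that `q := M𝒪_F`
is a single place; the newform `g` is ordinary at `p` (Fontaine–Edixhoven: weight `2 ≤ k ≤ p - 2`, level prime to `p`,
locally reducible residual representation) with UNRAMIFIED unit root `≡ ε₁ = 1`, so that after restriction to `Γ_F`
and the Teichmüller twist by `χ̄_a` the unit-root character is `≡ χ̄_a` at EVERY `v ∣ p` — the uniform Skinner–Wiles
orientation the crux demands (landed `Negative.oriented_of_unitRoot_congr`), automatically, because `ε₁` is a character
of `Γ_ℚ`; Langlands' quadratic base change carries `π_g` to a cuspidal (no CM by `F`: `χ̄|Γ_F ≠ 1` by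
`p`-distinguishedness) regular L-algebraic `Π` on `GL₂(𝔸_F)` of conductor `cond(χ̄_a)cond(χ̄_b)·q·p^∞`-type, and the
Eichler–Shimura–Harder / completed-cohomology dictionary makes `r := ρ_g|_{Γ_F} ⊗ ν̃` a continuous `ℚ̄_p`-point of
`𝕋(𝒰)` with `𝒰.bad = {v ∣ p} ∪ {q} ∪ {residually ramified places}`.

THE REGIME (`InBMRange`, §0): `p ≥ 5` ∧ the ratio descends to an odd `η̄` (witnessed by a continuous unit-valued lift
`η : Γ_ℚ → ℚ̄_pˣ`; every condition on `η` is RESIDUAL, so the choice of lift is immaterial) ∧ WINDOW `η̄|I_p ∉ {1, ω⁻¹}`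
(Serre weight `2 ≤ k ≤ p - 2`, BM's `ℓ > k + 1`; it also makes `1 ⊕ η̄` `p`-distinguished over `ℚ` and the orientation
forced) ∧ NOT the MAZUR CORNER (`η̄ = ω` with `F = ℚ(√-p)`, `p ≡ 3 (4)`, i.e. `F ⊂ ℚ(ζ_p)`: then every Mazur prime
`M ≡ 1 (mod p)` splits in `F` and no inert level-raising prime exists — the ONLY failure of the inert supply, by the
parity argument of triage r1-3: `η̄` odd ⇒ `η̄ω` even ⇒ `ε_F ∉ ⟨η̄ω⟩`).  Everything else — GENUINE pairs (ratio not
`Gal(F/ℚ)`-invariant: by Clifford theory not restrictions of uniformly-oriented modular `ρ̄` over `ℚ`, card §Dead lines /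
Disproof §7C), descended pairs of EDGE inertial type (`χ̄|I_v ∈ {1, ω⁻¹}·`: Serre weights `p - 1, p`), `p = 3`, and the
Mazur corner — is the CONCEDED complement `stub_complementRegimeSeed` (S6): NOT a lemma of this line; it is the
docking port for the merged geometric line (big-image-cousin ≈ ell-switch-geometric-seed, whose own skeleton has a
`stub_descended` that THIS file decomposes) and, beyond elliptic type, the residual universal crux (triage r1-2 coverage
map (E)+(G); Disproof §7D "truth-value genuinely unknown in the genuine regime").

SHAPE.  S1 `stub_inertBMPrimeSupply` (Chebotarev = Dirichlet for the abelian field `F(ζ_p, η̄)` + parity; size S on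
paper, M in Lean — Kronecker–Weber/Artin map for characters of `Γ_ℚ`; PROVABLE NOW modulo tree facts) → S2
`stub_levelRaisedEisensteinNewformQ` (over `ℚ`: BM Thm 2 / strong modularity + Carayol + Deligne's `ρ_g` + Ribet's
irreducibility and lattice + Fontaine–Edixhoven ordinarity + the oriented frame; theorem-grade in print, size L–XL in
Lean) → S3 `stub_restrictTwistGaloisPackage` (pure Galois bookkeeping: restriction along `absGaloisRestrict ℚ F`,
Teichmüller twist, Clifford irreducibility from `p`-distinguishedness, transport of the oriented frame along residually
Borel integral conjugation, the level set `S = {v ∣ p} ∪ {q} ∪ {residually ramified}` with its finiteness from `hunr`;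
PROVABLE NOW, size L in Lean) → S4 `stub_quadraticBaseChangeTwist` (Langlands 1980 / Arthur–Clozel quadratic base
change with local–global compatibility at every `v ∤ p`, plus the finite-order twist; theorem-grade in print, XL in Lean)
→ S5 `stub_cuspidalCohomologicalPoint` (the DICTIONARY D1 shared by all five cards and, reversed, by the exit crux
stmt-Langlands-12921: a cuspidal regular L-algebraic `Π` over `F` Satake–Frobenius-compatible with `r` outside a finite
`S ⊇ {v ∣ p}` makes `r` a continuous point of `𝕋(𝒰)` with `𝒰.bad = S` — Eichler–Shimura–Harder/Franke + the CONSTRUCTED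
`𝕋(𝒰)` of `CompletedCohomologyHeckeAlgebraGLn`, normalisation fixed by the landed `Negative.BorelAndEisenstein`
(`x(T_{v,1}) = tr r(Frob_v)`, `q_v x(T_{v,2}) = det r(Frob_v)`, arithmetic Frobenius); theorem-grade in print, L–XL in
Lean); outside the regime S6 (conceded).  The glue `seed_of_inBMRange` shows that on the BM range the conclusion is
reached from `(hunr, hmod, p-distinguishedness)` ALONE — irreducibility, ordinarity, orientation and the weight of `ρ`
are not consumed (Disproof §3 `crux_of_pairSeed`: no hypothesis on `ρ` is load-bearing for the method; `hunr` is used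
only as the finiteness certificate of the residually ramified set).

DISPROOF USED (`Cruxes/EisensteinProModularSeed/Disproof.lean`, cdisprove gen 1 + gen 2 cycle 1 v3, tree commit
d48643eb86d3, read in full 2026-08-16; it has NO `_false_without_` theorem — §3: none is provable, both sides are
interface-level).  §1 `concl_congr`/`crux_iff_pairSeedArising`: honoured — S3 consumes `ρ₀` only through its residual
diagonal (descent relation, `DiagCongr` output) and `ρ` only through `hunr`/`hmod`.  §6.1 `seedNoLevel_of_engine`
(the one-`q` clause is the seed's whole content): the line's content is exactly the production of `q = M𝒪_F` with `M`
INERT (S1) and the level set `S` of S3 whose last conjunct IS the clause; no stub is the engine in disguise (no stub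
takes `r := ρ`).  §6.3 `orientedFrame_diag_congr`/`concl_orientation_residual` and §6.3c `oriented_of_unitRoot_congr`
(LANDED, `Negative/OrientedFrame.lean`, imported): S2's clause `(ord)` is the crux's oriented clause over `ℚ_p` with
`m = 1` and unit root `≡ 1 = (ρ'₀)₀₀`, S3 transports it to every `v ∣ p` with unit root `≡ ν̄ = χ̄_a` — the uniform
orientation; the dihedral/`Ind_F^ℚ` variant (mixed orientation at split `p`, §7C) is NOT used anywhere.  §6.3b
`concl_inertial_type`: consistent — S3 outputs `m = ord(ν)`, `χ̄_a|I_v` of order `∣ m`, `χ̄_b|I_v = ω^{k-1}·`(order `∣ m`).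
§2 `concl_level_control` + B1 `eigensystem_apply_eq_zero_of_nsmul_eq_zero`: the point comes from a characteristic-0
cuspidal newform (S2) through base change (S4) and the dictionary (S5) — no torsion class, no Ihara lemma over `F`, no
phantom class.  §6.2 `concl_witness_not_borel`: `r` is irreducible by Clifford + distinguishedness (S3), never Borel.
§7C (Berger/degree-one congruences dead for the typed clause): not used.  Landed Negative lemmas (`OrientedFrame`,
`BorelAndEisenstein`, both imported here): hygiene/orientation/normalisation lemmas, no `¬`-statement — checked: no stub
is an instance of anything refuted.  Negatives index (`ledger negatives --problem Langlands`): 1 entry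
(stmt-Langlands-3797, K3 Kuga–Satake anchor), unrelated.
-/

set_option linter.dupNamespace false
set_option linter.unusedVariables false

noncomputable section

namespace Summit.Langlands.Langlands.Cruxes.EisensteinProModularSeed.DescendRaiseBasechange

open Summit.Langlands.Langlands.Theses.SkinnerWilesDefectOne
open Literature.NumberTheory.Automorphic Literature.NumberTheory.GaloisRepresentations
open Literature.NumberTheory.Automorphic.BigHeckeGLn
open NumberField IsDedekindDomain IsLocalRing Filter Field

/-! ## 0. Vocabulary used only by the readable statements and the glue (never by the registered stubs) -/

/-- The `p`-adic cyclotomic character of `ℚ` as an element of `ℚ̄_p` (the crux's spelling of the local clause with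
`K = ℚ`): `cyc p τ = ε(τ)`, so `Valued.v (η τ - cyc p τ) < 1` reads `η̄(τ) = ω̄(τ)`. [folklore] -/
def cyc (p : ℕ) [Fact p.Prime] (τ : absoluteGaloisGroup ℚ) : PadicAlgCl p :=
  algebraMap (Padic p) (PadicAlgCl p)
    (((GaloisRep.cyclotomicCharacter ℚ p τ).val : PadicInt p) : Padic p)

/-- **The regime of this line** (`InBMRange F p O ρ₀`). `p ≥ 5`, and there is a continuous character
`η : Γ_ℚ → ℚ̄_pˣ` with unit values (a lift of a residual character `η̄ : Γ_ℚ → 𝔽̄_pˣ`; only `η̄` matters) such that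
* DESCENT: `η̄(σ|_ℚ) · χ̄_a(σ) = χ̄_b(σ)` for all `σ ∈ Γ_F` (`σ|_ℚ = absGaloisRestrict ℚ F σ`; `χ̄_a, χ̄_b` the residual
  diagonal of `ρ₀`) — the ratio `χ̄_b/χ̄_a` extends to `Γ_ℚ`;
* ODD: `η̄(c) = -1` at complex conjugation (so `1 ⊕ η̄` is odd; of the two extensions `η̄, η̄ε_F` of a
  `Gal(F/ℚ)`-invariant ratio exactly one is odd);
* WINDOW at `p`: on the inertia group at (every prime of `ℚ̄` above) `p`, `η̄ ≠ 1` and `η̄ω ≠ 1`, i.e. `η̄|I_p = ω^j` with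
  `1 ≤ j ≤ p - 3` — Serre weight `k = j + 1 ∈ [2, p - 2]`, Billerey–Menares' `ℓ > k + 1`;
* NOT the MAZUR CORNER: not (`η̄ = ω̄` ∧ `p ≡ 3 (mod 4)` ∧ `-p` is a square in `F`), i.e. not (`(N, k) = (1, 2)` with
  `F = ℚ(√-p) ⊂ ℚ(ζ_p)`, where Mazur's primes `M ≡ 1 (mod p)` all split in `F`). [folklore] -/
def InBMRange (F : Type) [Field F] [NumberField F] (p : ℕ) [Fact p.Prime]
    (O : ValuationSubring (PadicAlgCl p))
    (ρ₀ : absoluteGaloisGroup F →* Matrix.GeneralLinearGroup (Fin 2) O) : Prop :=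
  5 ≤ p ∧ ∃ η : absoluteGaloisGroup ℚ →ₜ* (PadicAlgCl p)ˣ,
    (∀ τ, Valued.v ((η τ : (PadicAlgCl p)ˣ) : PadicAlgCl p) = 1) ∧
    (∀ σ : absoluteGaloisGroup F,
      Valued.v (((η (absGaloisRestrict ℚ F σ) : (PadicAlgCl p)ˣ) : PadicAlgCl p) *
          ((ρ₀ σ).val 0 0 : PadicAlgCl p) - ((ρ₀ σ).val 1 1 : PadicAlgCl p)) < 1) ∧
    (∀ c : absoluteGaloisGroup ℚ, IsComplexConjugation (Rat.castHom ℝ) c →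
      Valued.v (((η c : (PadicAlgCl p)ˣ) : PadicAlgCl p) + 1) < 1) ∧
    (∀ w : HeightOneSpectrum (𝓞 ℚ), (p : 𝓞 ℚ) ∈ w.asIdeal → ∀ 𝔓 ∈ w.primesAbove,
      (∃ σ ∈ 𝔓.inertia (absoluteGaloisGroup ℚ),
        ¬ Valued.v (((η σ : (PadicAlgCl p)ˣ) : PadicAlgCl p) - 1) < 1) ∧
      (∃ σ ∈ 𝔓.inertia (absoluteGaloisGroup ℚ),
        ¬ Valued.v (((η σ : (PadicAlgCl p)ˣ) : PadicAlgCl p) * cyc p σ - 1) < 1)) ∧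
    ¬ ((∀ τ, Valued.v (((η τ : (PadicAlgCl p)ˣ) : PadicAlgCl p) - cyc p τ) < 1) ∧
        p % 4 = 3 ∧ ∃ x : F, x ^ 2 = -(p : F))

/-! ## 1. The statements of the six stubs (`S.stub_*`, readable form; taken BY NAME as the hypotheses of
`EisensteinProModularSeed_of`; the sorried registered `stub_*` of §2 restate them verbatim, fully qualified) -/

/-- **STUB 1 — `inertBMPrimeSupply` (the card's First lemma, made hypothesis-free by triage r1-3's parity remark;
size S on paper / M in Lean; PROVABLE NOW modulo class field theory over `ℚ`).**  For `F` imaginary quadratic,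
`p ≥ 5`, and a continuous unit-valued `η : Γ_ℚ → ℚ̄_pˣ` whose reduction `η̄` is ODD and not in the Mazur corner,
there is a prime `M ≠ p`, INERT in `F` (`M𝒪_F` prime), with `η̄` unramified at `M`, the Billerey–Menares congruence
`η̄(Frob_M) · M ≡ 1 (mod 𝔪)` at every arithmetic Frobenius above `M`, and Mazur's `M ≡ 1 (mod p)` whenever
`η̄ = ω̄`.  Intended proof: `K := F(ζ_p, ℚ̄^{ker η̄})` is ABELIAN over `ℚ`, so Chebotarev is Dirichlet's theorem
(Mathlib `Nat.setOf_prime_and_eq_mod_infinite`) once Kronecker–Weber / the Artin map identify `η̄` and `ε_F` with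
Dirichlet characters; one needs `σ ∈ Gal(K/ℚ)` with `σ|_F = c` and `(η̄ω)(σ) = 1`: it exists iff `ε_F ∉ ⟨η̄ω⟩`,
which ALWAYS holds since `η̄ω` is even (`η̄(c) = ω(c) = -1`) and `ε_F` is odd; in the Mazur case `η̄ = ω` one needs
`σ|_{ℚ(ζ_p)} = 1`, `σ|_F = c`, which exists iff `F ⊄ ℚ(ζ_p)` iff not (`p ≡ 3 (4)` and `F = ℚ(√-p)`) — the excluded
corner; finally discard the finitely many `M ∣ p · cond(η̄) · d_F`.  WHY IT MIGHT FAIL: only if the tree's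
`IsComplexConjugation (Rat.castHom ℝ)` were uninhabited (it is not: complex conjugations exist) — then ODD would be
vacuous and `η̄ = 1`, `F = ℚ(√-p)` a counterexample; Lean cost is the Artin map for `Γ_ℚ`-characters.
[BillereyMenares2018 Thm 2 ("infinitely many such primes"); Mazur1977; Serre, Cours d'arithmétique VI (Dirichlet);
triage r1-1 / r1-2 / r1-3 sharpenings] -/
def S.stub_inertBMPrimeSupply : Prop :=
  ∀ (F : Type) [Field F] [NumberField F], IsTotallyComplex F → Module.finrank ℚ F = 2 →
    ∀ (p : ℕ) [Fact p.Prime], 5 ≤ p →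
    ∀ (η : absoluteGaloisGroup ℚ →ₜ* (PadicAlgCl p)ˣ),
    (∀ τ, Valued.v ((η τ : (PadicAlgCl p)ˣ) : PadicAlgCl p) = 1) →
    (∀ c : absoluteGaloisGroup ℚ, IsComplexConjugation (Rat.castHom ℝ) c →
      Valued.v (((η c : (PadicAlgCl p)ˣ) : PadicAlgCl p) + 1) < 1) →
    ¬ ((∀ τ, Valued.v (((η τ : (PadicAlgCl p)ˣ) : PadicAlgCl p) - cyc p τ) < 1) ∧
        p % 4 = 3 ∧ ∃ x : F, x ^ 2 = -(p : F)) →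
    ∃ M : ℕ, M.Prime ∧ M ≠ p ∧ (Ideal.span {(M : 𝓞 F)}).IsPrime ∧
      (∀ w : HeightOneSpectrum (𝓞 ℚ), (M : 𝓞 ℚ) ∈ w.asIdeal → ∀ 𝔓 ∈ w.primesAbove,
        ∀ σ ∈ 𝔓.inertia (absoluteGaloisGroup ℚ),
          Valued.v (((η σ : (PadicAlgCl p)ˣ) : PadicAlgCl p) - 1) < 1) ∧
      (∀ w : HeightOneSpectrum (𝓞 ℚ), (M : 𝓞 ℚ) ∈ w.asIdeal → ∀ 𝔓 ∈ w.primesAbove,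
        ∀ σ : absoluteGaloisGroup ℚ, IsArithFrobAt (𝓞 ℚ) σ 𝔓 →
          Valued.v (((η σ : (PadicAlgCl p)ˣ) : PadicAlgCl p) * (M : PadicAlgCl p) - 1) < 1) ∧
      ((∀ τ, Valued.v (((η τ : (PadicAlgCl p)ˣ) : PadicAlgCl p) - cyc p τ) < 1) → M % p = 1)

/-- **STUB 2 — `levelRaisedEisensteinNewformQ` (the `ℚ`-side package; theorem-grade in print, size L–XL in Lean:
mod-`p` modular forms of Serre type, BM's Eisenstein-series argument, Deligne–Carayol, Ribet's lattice — none in the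
tree).**  For `p ≥ 5`, `O = 𝒪_{ℚ̄_p}`, a continuous unit-valued `η : Γ_ℚ → ℚ̄_pˣ` with `η̄` odd and in the window,
and a prime `M ≠ p` with `η̄` unramified at `M`, `η̄(Frob_M)·M ≡ 1` and (`η̄ = ω̄ ⇒ M ≡ 1 (mod p)`), there are
`k ≥ 2` (namely the Serre weight `j + 1`), a continuous `ρ' : Γ_ℚ → GL₂(ℚ̄_p)` and an integral model `ρ'₀` in the
same frame with: (irr) `ρ'` irreducible; (diag) `ρ'₀` residually upper triangular with ORDERED residual diagonal
`(1, η̄)`; (ord) at the place above `p`, an ORIENTED frame `Q` (`‖Q₀₀‖ ≤ ‖Q₁₀‖`) in which `ρ'|_{Γ_{ℚ_p}}` is upper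
triangular with `θ₂ = 1` and `θ₁ = ε^{k-1}` on inertia (the crux's clause over `ℚ_p` with `m = 1`); (lev) at every
place `w ∤ Mp`, inertia elements killed by `η̄` act trivially through `ρ'` (i.e. `ρ'|_{I_w} ≅ 1 ⊕ η̃|_{I_w}`: tame
conductor `cond(η̄) · M^{≤1}`); (mod) for the compactness datum `hcpt` there are `ι : ℚ̄_p ≃ ℂ`,
a cuspidal automorphic `π` on `GL₂(𝔸_ℚ)` with a REGULAR L-ALGEBRAIC infinity type, Satake–Frobenius
compatible with `ρ'` at all but finitely many places.  Intended proof: `ρ̄ := 1 ⊕ η̄` is odd of Serre type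
`(N, k, ε)`, `N = cond(η̄ω^{-j})` prime to `p`, `k = j + 1 ∈ [2, p-2]` (window), `ε = η̄ω^{-j}`; if `ρ̄` is strongly
modular take the level-`N` newform (Carayol), else BillereyMenares2018 Thm 2 (p. 3 read; `η_BM = ε₁⁻¹ε₂ = η̄ω^{-j}`, the
condition `η_BM(M)M^k = η̄(Frob_M)M^{-j}M^{j+1} = η̄(Frob_M)·M = 1`; Mazur1977 for `(N,k) = (1,2)` ⟺ `η̄ = ω`) gives a
newform `g` of level `NM`, weight `k`, nebentypus `ε`, with `ρ̄_g^ss ≅ 1 ⊕ η̄`; `ρ' := ρ_{g,ι}` (Deligne) is irreducible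
(Ribet), ordinary at `p` (Fontaine–Edixhoven: `2 ≤ k ≤ p - 1`, `p ∤ NM`, and `ρ̄_g|_{D_p}` reducible ⇒ `a_p` a unit)
with `ρ_g|_{I_p} ≅ (ε^{k-1} ∗; 0 1)` (Deligne/Wiles), unit-root character unramified and `≡ 1` (`a_p ≡ 1 + ε(p)p^{k-1}`),
hence, `η̄|_{D_p}` being `≠ 1` (window), ORIENTED w.r.t. the Ribet lattice `ρ'₀` with residual sub `1` (Ribet1976, both
orderings available for irreducible `ρ_g`; orientation by `Negative.oriented_of_unitRoot_congr`); (lev) by Carayol's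
local–global compatibility at `w ∣ N` (`a(π_w) = a(ε_w)` forces a principal series `PS(unr, ε_w)`, so `ρ_g|_{I_w} ≅
1 ⊕ ε̃|_{I_w}`) and unramifiedness off `NMp`; (mod) with the L-algebraic twist of `π_g` (resp. its contragredient) in
the normalisation of `SatakeFrobCompatibleAt`.  WHY IT MIGHT FAIL: a hidden hypothesis in BM Thm 2 beyond `ℓ > k+1`
(none on p. 3; N arbitrary, ε arbitrary); the `(1,2)`/Mazur dichotomy is encoded by `η̄ = ω̄`; the local type at `w ∣ N`
with `a(π_w) = a(ε_w)` must be principal series (standard).  [BillereyMenares2018 Thms 1–2; Mazur1977 II.9; Carayol1986;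
Deligne1971; DeligneSerre1974; Ribet1976; Edixhoven1992 Thm 2.5–2.6; Serre1987 §2; SkinnerWiles1999 §1] -/
def S.stub_levelRaisedEisensteinNewformQ : Prop :=
  ∀ (p : ℕ) [Fact p.Prime], 5 ≤ p → ∀ (O : ValuationSubring (PadicAlgCl p)),
    O = (Valued.v : Valuation (PadicAlgCl p) NNReal).valuationSubring →
    ∀ (η : absoluteGaloisGroup ℚ →ₜ* (PadicAlgCl p)ˣ) (M : ℕ),
    (∀ τ, Valued.v ((η τ : (PadicAlgCl p)ˣ) : PadicAlgCl p) = 1) →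
    (∀ c : absoluteGaloisGroup ℚ, IsComplexConjugation (Rat.castHom ℝ) c →
      Valued.v (((η c : (PadicAlgCl p)ˣ) : PadicAlgCl p) + 1) < 1) →
    (∀ w : HeightOneSpectrum (𝓞 ℚ), (p : 𝓞 ℚ) ∈ w.asIdeal → ∀ 𝔓 ∈ w.primesAbove,
      (∃ σ ∈ 𝔓.inertia (absoluteGaloisGroup ℚ),
        ¬ Valued.v (((η σ : (PadicAlgCl p)ˣ) : PadicAlgCl p) - 1) < 1) ∧
      (∃ σ ∈ 𝔓.inertia (absoluteGaloisGroup ℚ),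
        ¬ Valued.v (((η σ : (PadicAlgCl p)ˣ) : PadicAlgCl p) * cyc p σ - 1) < 1)) →
    M.Prime → M ≠ p →
    (∀ w : HeightOneSpectrum (𝓞 ℚ), (M : 𝓞 ℚ) ∈ w.asIdeal → ∀ 𝔓 ∈ w.primesAbove,
      ∀ σ ∈ 𝔓.inertia (absoluteGaloisGroup ℚ),
        Valued.v (((η σ : (PadicAlgCl p)ˣ) : PadicAlgCl p) - 1) < 1) →
    (∀ w : HeightOneSpectrum (𝓞 ℚ), (M : 𝓞 ℚ) ∈ w.asIdeal → ∀ 𝔓 ∈ w.primesAbove,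
      ∀ σ : absoluteGaloisGroup ℚ, IsArithFrobAt (𝓞 ℚ) σ 𝔓 →
        Valued.v (((η σ : (PadicAlgCl p)ˣ) : PadicAlgCl p) * (M : PadicAlgCl p) - 1) < 1) →
    ((∀ τ, Valued.v (((η τ : (PadicAlgCl p)ˣ) : PadicAlgCl p) - cyc p τ) < 1) → M % p = 1) →
    ∃ (k : ℕ) (ρ' : FramedGaloisRep ℚ (PadicAlgCl p) 2)
      (ρ'₀ : absoluteGaloisGroup ℚ →* Matrix.GeneralLinearGroup (Fin 2) O),
      2 ≤ k ∧ ρ'.toGaloisRep.IsIrreducible ∧ ρ'.HasUpperTriangularIntegralModel ρ'₀ ∧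
      (∀ g, ((ρ'₀ g).val 0 0 - 1 : O) ∈ maximalIdeal O ∧
        Valued.v (((ρ'₀ g).val 1 1 : PadicAlgCl p) - ((η g : (PadicAlgCl p)ˣ) : PadicAlgCl p)) < 1) ∧
      (∀ w : HeightOneSpectrum (𝓞 ℚ), (p : 𝓞 ℚ) ∈ w.asIdeal →
        ∃ Q : Matrix.GeneralLinearGroup (Fin 2) (PadicAlgCl p),
          Valued.v (Q.val 0 0) ≤ Valued.v (Q.val 1 0) ∧
          ∀ σ, (Q⁻¹ * ρ'.toLocal w σ * Q).val 1 0 = 0 ∧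
            (σ ∈ absInertia (w.adicCompletion ℚ) →
              (Q⁻¹ * ρ'.toLocal w σ * Q).val 1 1 = 1 ∧
              (Q⁻¹ * ρ'.toLocal w σ * Q).val 0 0 =
                algebraMap (Padic p) (PadicAlgCl p)
                  (((GaloisRep.cyclotomicCharacter (w.adicCompletion ℚ) p σ).val : PadicInt p) :
                    Padic p) ^ (k - 1))) ∧
      (∀ w : HeightOneSpectrum (𝓞 ℚ), (M : 𝓞 ℚ) ∉ w.asIdeal → (p : 𝓞 ℚ) ∉ w.asIdeal →
        ∀ 𝔓 ∈ w.primesAbove, ∀ σ ∈ 𝔓.inertia (absoluteGaloisGroup ℚ),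
          Valued.v (((η σ : (PadicAlgCl p)ˣ) : PadicAlgCl p) - 1) < 1 → ρ' σ = 1) ∧
      ∀ hcpt : isCompact_glFiniteIntegralLevel 2 ℚ,
        ∃ (ι : PadicAlgCl p ≃+* ℂ) (π : CuspidalAutomorphicRepData 2 ℚ hcpt) (T : InfinityType ℚ 2),
          π.1.HasInfinityType T ∧ T.IsLAlgebraic ∧ T.IsRegular ∧
          ∀ᶠ w in cofinite, Summit.Langlands.SatakeFrobCompatibleAt ι π.1 ρ' w

/-- **STUB 3 — `restrictTwistGaloisPackage` (Galois-side transport; size M on paper / L in Lean; PROVABLE NOW).**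
`F` imaginary quadratic, any `p`, `O = 𝒪_{ℚ̄_p}`; `(ρ, ρ₀)` a continuous `Γ_F → GL₂(ℚ̄_p)` with residually upper
triangular integral model, unramified a.e., `p`-distinguished at every `v ∣ p` (the crux's data, minus irreducibility
and ordinarity — NOT used); `(η, M, k, ρ', ρ'₀)` as output by STUB 2 (unit-valued continuous `η`, DESCENT relation
`η̄(σ|_ℚ) χ̄_a(σ) = χ̄_b(σ)`, `M` a rational prime INERT in `F`, `k ≥ 2`, `ρ'` irreducible with integral model of
ordered residual diagonal `(1, η̄)`, the oriented ordinary clause over `ℚ_p` with `m = 1`, and (lev)).  THEN, with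
`ν :=` the Teichmüller lift of `χ̄_a` (continuous, of finite order `n`, unramified exactly where `χ̄_a` is) and
`r := ν ⊗ ρ'|_{Γ_F}` (restriction along `absGaloisRestrict ℚ F`; framed by `(r σ) = ν(σ) • ρ'(σ|_ℚ)`),
`r₀ := ν ⊗ ρ'₀|_{Γ_F}`, `q := M𝒪_F` and `S := {v ∣ p} ∪ {q} ∪ {v : χ̄_a or χ̄_b ramified at v}`: `r` is IRREDUCIBLE
(if not, Clifford theory for the index-2 subgroup `Γ_F ⊲ Γ_ℚ` makes `ρ' ≅ Ind_F^ℚ ψ`, so `{ψ̄, ψ̄^c} = {1, χ̄_b/χ̄_a}`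
forces `χ̄_b/χ̄_a = 1` on `Γ_F`, against distinguishedness at any `v ∣ p`); `r₀` is an integral model of `r` with the
SAME ordered residual diagonal as `ρ₀` (`ν̄ · 1 = χ̄_a`, `ν̄ · η̄|_F = χ̄_b`); `r` is oriented-ordinary of the parallel
weight `k` with exponent `m := n` at every `v ∣ p` (the frame `Q` of (ord) transported along `Γ_{F_v} → Γ_F → Γ_ℚ`,
which lands in a decomposition group at `p` conjugate to the image of `Γ_{ℚ_p}` by an element `τ`; conjugating by the
integral residually-Borel matrix `ρ'₀(τ)` keeps the orientation — Disproof §2 `orientation_mul_of_residuallyBorel`, or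
directly `Negative.oriented_of_unitRoot_congr` with unit root `≡ ν̄ = χ̄_a` and distinguishedness; `θ₂ = ν` on inertia,
`θ₂^n = 1`, `θ₁^n = ε^{(k-1)n}`; compatibility of the cyclotomic characters of `ℚ`, `ℚ_p`, `F_v` under the restriction
maps); `S` is finite (`{residually ramified} ⊆ {ρ ramified}`, finite by `hunr`), contains the places above `p`, `r` is
UNRAMIFIED outside `S` (at `v ∉ S`: `v ∤ pM` since `q` is the ONLY place above the inert `M`, and for `σ ∈ I_v`,
`ν(σ) = 1` and `η̄(σ|_ℚ) = (χ̄_b/χ̄_a)(σ) = 1`, so `ρ'(σ|_ℚ) = 1` by (lev) — `σ|_ℚ` lies in an inertia group of `Γ_ℚ`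
above `v ∩ ℚ`), and the crux's LEVEL CLAUSE holds for `S` (a place `v ≠ q`, `v ∤ p` with both residual characters
unramified is not in `S` by definition).  WHY IT MIGHT FAIL: only Lean depth — Teichmüller lifts `κˣ → Oˣ` for
`O = 𝒪_{ℚ̄_p}` (Hensel for prime-to-`p` roots of unity), continuity/finite image of residual characters of a continuous
`ρ`, index-2 image of `absGaloisRestrict ℚ F`, inertia groups under `absGaloisRestrict`; all folklore.
[SkinnerWiles1999 §1; Ribet1976 §2 (lattices); Serre, Abelian ℓ-adic representations I §2.1; Curtis–Reiner §11
(Clifford); triage r1-2 normal form `ε₁ = 1, ν̄ = χ̄_a`] -/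
def S.stub_restrictTwistGaloisPackage : Prop :=
  ∀ (F : Type) [Field F] [NumberField F], IsTotallyComplex F → Module.finrank ℚ F = 2 →
    ∀ (p : ℕ) [Fact p.Prime] (O : ValuationSubring (PadicAlgCl p)),
    O = (Valued.v : Valuation (PadicAlgCl p) NNReal).valuationSubring →
    ∀ (ρ : FramedGaloisRep F (PadicAlgCl p) 2)
      (ρ₀ : absoluteGaloisGroup F →* Matrix.GeneralLinearGroup (Fin 2) O),
    (∀ᶠ v in cofinite, ρ.IsUnramifiedAt v) → ρ.HasUpperTriangularIntegralModel ρ₀ →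
    (∀ v : HeightOneSpectrum (𝓞 F), (p : 𝓞 F) ∈ v.asIdeal → IsPDistinguishedAt ρ₀ v) →
    ∀ (η : absoluteGaloisGroup ℚ →ₜ* (PadicAlgCl p)ˣ) (M k : ℕ)
      (ρ' : FramedGaloisRep ℚ (PadicAlgCl p) 2)
      (ρ'₀ : absoluteGaloisGroup ℚ →* Matrix.GeneralLinearGroup (Fin 2) O),
    (∀ τ, Valued.v ((η τ : (PadicAlgCl p)ˣ) : PadicAlgCl p) = 1) →
    (∀ σ : absoluteGaloisGroup F,
      Valued.v (((η (absGaloisRestrict ℚ F σ) : (PadicAlgCl p)ˣ) : PadicAlgCl p) *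
          ((ρ₀ σ).val 0 0 : PadicAlgCl p) - ((ρ₀ σ).val 1 1 : PadicAlgCl p)) < 1) →
    M.Prime → (Ideal.span {(M : 𝓞 F)}).IsPrime → 2 ≤ k →
    ρ'.toGaloisRep.IsIrreducible → ρ'.HasUpperTriangularIntegralModel ρ'₀ →
    (∀ g, ((ρ'₀ g).val 0 0 - 1 : O) ∈ maximalIdeal O ∧
      Valued.v (((ρ'₀ g).val 1 1 : PadicAlgCl p) - ((η g : (PadicAlgCl p)ˣ) : PadicAlgCl p)) < 1) →
    (∀ w : HeightOneSpectrum (𝓞 ℚ), (p : 𝓞 ℚ) ∈ w.asIdeal →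
      ∃ Q : Matrix.GeneralLinearGroup (Fin 2) (PadicAlgCl p),
        Valued.v (Q.val 0 0) ≤ Valued.v (Q.val 1 0) ∧
        ∀ σ, (Q⁻¹ * ρ'.toLocal w σ * Q).val 1 0 = 0 ∧
          (σ ∈ absInertia (w.adicCompletion ℚ) →
            (Q⁻¹ * ρ'.toLocal w σ * Q).val 1 1 = 1 ∧
            (Q⁻¹ * ρ'.toLocal w σ * Q).val 0 0 =
              algebraMap (Padic p) (PadicAlgCl p)
                (((GaloisRep.cyclotomicCharacter (w.adicCompletion ℚ) p σ).val : PadicInt p) :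
                  Padic p) ^ (k - 1))) →
    (∀ w : HeightOneSpectrum (𝓞 ℚ), (M : 𝓞 ℚ) ∉ w.asIdeal → (p : 𝓞 ℚ) ∉ w.asIdeal →
      ∀ 𝔓 ∈ w.primesAbove, ∀ σ ∈ 𝔓.inertia (absoluteGaloisGroup ℚ),
        Valued.v (((η σ : (PadicAlgCl p)ˣ) : PadicAlgCl p) - 1) < 1 → ρ' σ = 1) →
    ∃ (r : FramedGaloisRep F (PadicAlgCl p) 2)
      (r₀ : absoluteGaloisGroup F →* Matrix.GeneralLinearGroup (Fin 2) O)
      (ν : absoluteGaloisGroup F →ₜ* (PadicAlgCl p)ˣ) (q : HeightOneSpectrum (𝓞 F))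
      (S : Set (HeightOneSpectrum (𝓞 F))),
      (∃ n : ℕ, 0 < n ∧ ∀ σ, ν σ ^ n = 1) ∧
      (∀ σ, (r σ).val = ((ν σ : (PadicAlgCl p)ˣ) : PadicAlgCl p) • (ρ' (absGaloisRestrict ℚ F σ)).val) ∧
      r.toGaloisRep.IsIrreducible ∧ r.HasUpperTriangularIntegralModel r₀ ∧
      (∀ g, ((r₀ g).val 0 0 - (ρ₀ g).val 0 0 : O) ∈ maximalIdeal O ∧
        ((r₀ g).val 1 1 - (ρ₀ g).val 1 1 : O) ∈ maximalIdeal O) ∧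
      (∃ k' : ℕ, 2 ≤ k' ∧ ∃ m : ℕ, 0 < m ∧ ∀ v : HeightOneSpectrum (𝓞 F), (p : 𝓞 F) ∈ v.asIdeal →
        ∃ Q : Matrix.GeneralLinearGroup (Fin 2) (PadicAlgCl p),
          Valued.v (Q.val 0 0) ≤ Valued.v (Q.val 1 0) ∧
          ∀ σ, (Q⁻¹ * r.toLocal v σ * Q).val 1 0 = 0 ∧
            (σ ∈ absInertia (v.adicCompletion F) →
              (Q⁻¹ * r.toLocal v σ * Q).val 1 1 ^ m = 1 ∧
              (Q⁻¹ * r.toLocal v σ * Q).val 0 0 ^ m =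
                algebraMap (Padic p) (PadicAlgCl p)
                  (((GaloisRep.cyclotomicCharacter (v.adicCompletion F) p σ).val : PadicInt p) :
                    Padic p) ^ ((k' - 1) * m))) ∧
      S.Finite ∧ (∀ v : HeightOneSpectrum (𝓞 F), (p : 𝓞 F) ∈ v.asIdeal → v ∈ S) ∧
      (∀ v ∉ S, r.IsUnramifiedAt v) ∧
      (∀ v : HeightOneSpectrum (𝓞 F), v ≠ q → (p : 𝓞 F) ∉ v.asIdeal →
        (∀ 𝔓 ∈ v.primesAbove, ∀ σ ∈ 𝔓.inertia (absoluteGaloisGroup F),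
          ((ρ₀ σ).val 0 0 - 1 : O) ∈ maximalIdeal O ∧ ((ρ₀ σ).val 1 1 - 1 : O) ∈ maximalIdeal O) →
        v ∉ S)

/-- **STUB 4 — `quadraticBaseChangeTwist` (Langlands' quadratic base change for `GL₂` with local–global
compatibility away from `p`, plus a finite-order twist; theorem-grade in print, size XL in Lean — the tree has cyclic
base change only as the NAMED weak-lifting fact `ArthurClozel1989_weakLifting_cuspidal`).**  `F` imaginary quadratic,
`p` any prime, `ι : ℚ̄_p ≃ ℂ`; `π` a cuspidal automorphic representation of `GL₂(𝔸_ℚ)` with a REGULAR L-ALGEBRAIC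
infinity type, Satake–Frobenius compatible with a continuous `ρ' : Γ_ℚ → GL₂(ℚ̄_p)` at all but finitely many places;
`ν : Γ_F → ℚ̄_pˣ` continuous of finite order; `r := ν ⊗ ρ'|_{Γ_F}` IRREDUCIBLE; `S ⊇ {v ∣ p}` finite with `r`
unramified outside `S`.  THEN there is a cuspidal automorphic `Π` on `GL₂(𝔸_F)` with a regular L-algebraic infinity type
such that `SatakeFrobCompatibleAt ι Π r v` at EVERY `v ∉ S` (so `Π_v` is unramified wherever `r` is, `v ∤ p`).
Intended proof: `ρ'` is irreducible (as `r` is), hence `ρ' ≅ ρ_{π,ι}` (Chebotarev + Brauer–Nesbitt from a.e.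
compatibility); `π ≇ π ⊗ ε_F` (else `tr ρ'` vanishes on the inert Frobenii, `ρ' ≅ ρ' ⊗ ε_F`, `ρ'|_{Γ_F}` reducible);
so the base change `BC_{F/ℚ}(π)` is CUSPIDAL (Langlands1980; ArthurClozelAMS120 Ch. 3 Thm 4.2 (a) = the
tree's named fact `ArthurClozel1989_weakLifting_cuspidal`), regular L-algebraic (`InfinityType.baseChange`), and `Π := BC(π) ⊗ ν_𝔸`
(`ν_𝔸` the finite-order Hecke character of `ν` by class field theory, `twistByFiniteOrderChar`) has Galois representation
`r`; local–global compatibility at every `v ∤ p` (Carayol for `π`, compatibility of local base change with restriction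
of `L`-parameters, LLC for `GL₂`) gives: `r` unramified at `v` ⇒ `Π_v` unramified with Satake parameter matching
`r(Frob_v)` in the normalisation of `SatakeFrobCompatibleAt` (at an inert `v`, Frobenius `= Frob_w^2` and Satake
parameters square: the tree's `hasFrobCharpolyAt_restrictField_fin_two` bookkeeping).  WHY IT MIGHT FAIL: it is the
STRONG (all places `∤ p`) form of base change that is needed at the finitely many `v ∉ S` below ramified places of `π`
where `r` is nevertheless unramified (`ℓ ∣ d_F` with `ε`-type ramification, or ramification killed by the twist) — in
print for `GL₂` (Langlands 1980 proves the local identities everywhere), but not vendored.  [Langlands1980 (Base change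
for GL(2)); ArthurClozelAMS120 Ch. 3 Thms 4.2, 5.1; Carayol1986; BuzzardGeeLMS2014 §3 (normalisations)] -/
def S.stub_quadraticBaseChangeTwist : Prop :=
  ∀ (F : Type) [Field F] [NumberField F], IsTotallyComplex F → Module.finrank ℚ F = 2 →
    ∀ (p : ℕ) [Fact p.Prime] (hcptQ : isCompact_glFiniteIntegralLevel 2 ℚ) (ι : PadicAlgCl p ≃+* ℂ)
      (π : CuspidalAutomorphicRepData 2 ℚ hcptQ) (T : InfinityType ℚ 2),
    π.1.HasInfinityType T → T.IsLAlgebraic → T.IsRegular →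
    ∀ (ρ' : FramedGaloisRep ℚ (PadicAlgCl p) 2),
    (∀ᶠ w in cofinite, Summit.Langlands.SatakeFrobCompatibleAt ι π.1 ρ' w) →
    ∀ (ν : absoluteGaloisGroup F →ₜ* (PadicAlgCl p)ˣ), (∃ n : ℕ, 0 < n ∧ ∀ σ, ν σ ^ n = 1) →
    ∀ (r : FramedGaloisRep F (PadicAlgCl p) 2),
    (∀ σ, (r σ).val = ((ν σ : (PadicAlgCl p)ˣ) : PadicAlgCl p) • (ρ' (absGaloisRestrict ℚ F σ)).val) →
    r.toGaloisRep.IsIrreducible →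
    ∀ (S : Set (HeightOneSpectrum (𝓞 F))), S.Finite →
    (∀ v : HeightOneSpectrum (𝓞 F), (p : 𝓞 F) ∈ v.asIdeal → v ∈ S) →
    (∀ v ∉ S, r.IsUnramifiedAt v) →
    ∀ hcptF : isCompact_glFiniteIntegralLevel 2 F,
      ∃ (πF : CuspidalAutomorphicRepData 2 F hcptF) (T' : InfinityType F 2),
        πF.1.HasInfinityType T' ∧ T'.IsLAlgebraic ∧ T'.IsRegular ∧
        ∀ v ∉ S, Summit.Langlands.SatakeFrobCompatibleAt ι πF.1 r v

/-- **STUB 5 — `cuspidalCohomologicalPoint` (the DICTIONARY D1, classical ⇒ `p`-adic point; shared by every line of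
this crux and, reversed, by the exit crux; theorem-grade in print, size L–XL in Lean).**  `F` imaginary quadratic, `p`
any prime, `ι : ℚ̄_p ≃ ℂ`; `Π` a CUSPIDAL automorphic representation of `GL₂(𝔸_F)` with a REGULAR L-ALGEBRAIC
infinity type; `S ⊇ {v ∣ p}` a finite set of finite places; `r : Γ_F → GL₂(ℚ̄_p)` continuous with
`SatakeFrobCompatibleAt ι Π r v` for every `v ∉ S` (so `Π_v` and `r` are unramified off `S` and the arithmetic
Frobenius of `r` at `v` has characteristic polynomial `∏ (X - ι⁻¹(α_j⁻¹))`).  THEN there is a tame level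
`𝒰 : TameLevel 2 F p` with `𝒰.bad = S` such that `r` is `p`-adically automorphic of level `𝒰`: a CONTINUOUS ring map
`x : 𝕋(𝒰) → ℚ̄_p` with `charpoly r(Frob_v) = X² - x(T_{v,1})X + q_v x(T_{v,2})` for `v ∉ S`.  Intended proof:
`U := ∏_{v ∈ S, v ∤ p} K_v(c_v) × ∏_{v ∉ S or v ∣ p} GL₂(𝒪_v)` with `c_v ≥` the conductor exponent of `Π_v` is an
`S`-good `TameLevel` with `bad = S`; `Π' := Π^∨ ⊗ |det|^{1/2}` is regular C-algebraic, i.e. COHOMOLOGICAL (Clozel1990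
Lemme 3.14), so by Eichler–Shimura–Harder (Harder1987; Franke1998 / Borel for the comparison with `(𝔤,K)`-cohomology;
cuspidal ⇒ interior) its finite part contributes to `H^i(X_{U_r}, V_λ ⊗ ℂ)`, `i ∈ {1,2}`, with `U_r`-fixed vectors
(`r` large absorbs the level of `Π` at `p`); its spherical eigenvalues are algebraic integers, `t_{v,1} = q_v^{1/2}
e₁(α⁻¹q_v^{-1/2})·… = e₁(α⁻¹)`, `q_v t_{v,2} = e₂(α⁻¹)` — exactly the normalisation of `IsAssociated`
(`heckeFrobPoly`; `Negative.BorelAndEisenstein.trace_det_of_charpoly_eq_heckeFrobPoly`); transporting by `ι⁻¹`,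
reducing the integral lattice `V_λ(𝒪)` modulo `p^s` and trivialising it on the principal congruence subgroup of level
`p^s` at `v ∣ p` puts the reduced eigensystem in `H^i(X_{U_{r'}}, ℤ/p^s)` for `r' ≫ s` (Emerton2006 §2.2,
"completed cohomology sees all weights"; Scholze2015 §V.4 at finite level), compatibly in `(r', s)`, whence a continuous
`x : 𝕋(𝒰) = closure of the spherical algebra in ∏ End(H^i(X_{U_r}, ℤ/p^s)) → 𝒪 ⊂ ℚ̄_p`.  WHY IT MIGHT FAIL: only
Lean depth (no Eichler–Shimura–Harder / Franke comparison for the tree's `levelCohomology`, no local systems `V_λ` on the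
group-cohomology model, integrality of cohomological eigensystems); mathematically folklore.  [Harder1987; Franke1998;
Clozel1990 §3; Emerton2006 §2.2–2.3; Scholze2015 §V.4; GeeNewton2020 §2.1–§3.3; CalegariEmerton2011 §2;
triage r1-3 cross-cutting note 2 (file D1 once)] -/
def S.stub_cuspidalCohomologicalPoint : Prop :=
  ∀ (F : Type) [Field F] [NumberField F], IsTotallyComplex F → Module.finrank ℚ F = 2 →
    ∀ (p : ℕ) [Fact p.Prime] (hcpt : isCompact_glFiniteIntegralLevel 2 F) (ι : PadicAlgCl p ≃+* ℂ)
      (πF : CuspidalAutomorphicRepData 2 F hcpt) (T : InfinityType F 2),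
    πF.1.HasInfinityType T → T.IsLAlgebraic → T.IsRegular →
    ∀ (S : Set (HeightOneSpectrum (𝓞 F))), S.Finite →
    (∀ v : HeightOneSpectrum (𝓞 F), (p : 𝓞 F) ∈ v.asIdeal → v ∈ S) →
    ∀ (r : FramedGaloisRep F (PadicAlgCl p) 2),
    (∀ v ∉ S, Summit.Langlands.SatakeFrobCompatibleAt ι πF.1 r v) →
    ∃ 𝒰 : TameLevel 2 F p, 𝒰.bad = S ∧ 𝒰.IsPadicallyAutomorphic r

/-- **STUB 6 — `complementRegimeSeed` (the CONCEDED COMPLEMENT — NOT a lemma of this line).**  The crux VERBATIM,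
restricted to data OUTSIDE `InBMRange`: `p = 3`; or `p ≥ 5` and the residual ratio `χ̄_b/χ̄_a` is GENUINE (not the
restriction of a character of `Γ_ℚ`: not `Gal(F/ℚ)`-invariant); or it descends but only with an odd extension of EDGE
inertial type `η̄|I_p ∈ {1, ω⁻¹}` (Serre weights `p, p-1`: outside Billerey–Menares' `ℓ > k+1`, and for `η̄|I_p = 1`
the orientation is no longer forced); or the Mazur corner (`χ̄_b/χ̄_a = ω|_{Γ_F}`, `F = ℚ(√-p)`, `p ≡ 3 (4)`,
`p ≥ 7`: e.g. the `7`-isogeny pairs `(ν̄, ν̄ω)` over `ℚ(√-7)`).  WHY IT IS HERE: the skeleton must conclude the crux BY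
NAME for every admissible datum; this statement is the territory of the merged geometric line (big-image-cousin ≈
ell-switch-geometric-seed: `V_p` of modular elliptic curves / `GL₂`-type abelian varieties over `F` with an `F`-rational
`p`-isogeny, CaraianiNewton2023 Cor 6.1.1 / Thm 7.1, one-`q` = `S`-integrality on the twisted `X₁(p)`-conic; certified
instance kit j008657, `T = -9-4√-2`, `N(q) = 113`) on its elliptic-type population (E) (ratio `∈ ω·{ψ̄²}`, `p ≤ 7`), and
beyond it the residual universal crux (G) (triage r1-2 coverage map; Disproof §7D: no instance known where it fails,
none computable; a counterexample must defeat every `q` and every weight).  The lead should graft the geometric line's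
stubs here (its `stub_descended` is this file's P-branch).  Size: open problem.  [CaraianiNewton2023; SkinnerWiles1999
§3.4; CalegariMazur2008; Disproof §7D] -/
def S.stub_complementRegimeSeed : Prop :=
  ∀ (F : Type) [Field F] [NumberField F], IsTotallyComplex F → Module.finrank ℚ F = 2 →
    ∀ (p : ℕ) [Fact p.Prime], p ≠ 2 → ∀ (O : ValuationSubring (PadicAlgCl p)),
    O = (Valued.v : Valuation (PadicAlgCl p) NNReal).valuationSubring →
    ∀ (ρ : FramedGaloisRep F (PadicAlgCl p) 2)
      (ρ₀ : absoluteGaloisGroup F →* Matrix.GeneralLinearGroup (Fin 2) O),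
    ρ.toGaloisRep.IsIrreducible → (∀ᶠ v in cofinite, ρ.IsUnramifiedAt v) →
    ρ.HasUpperTriangularIntegralModel ρ₀ →
    (∃ k : ℕ, 2 ≤ k ∧ ∃ m : ℕ, 0 < m ∧ ∀ v : HeightOneSpectrum (𝓞 F), (p : 𝓞 F) ∈ v.asIdeal →
      IsPDistinguishedAt ρ₀ v ∧ ∃ Q : Matrix.GeneralLinearGroup (Fin 2) (PadicAlgCl p),
        Valued.v (Q.val 0 0) ≤ Valued.v (Q.val 1 0) ∧
        ∀ σ, (Q⁻¹ * ρ.toLocal v σ * Q).val 1 0 = 0 ∧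
          (σ ∈ absInertia (v.adicCompletion F) →
            (Q⁻¹ * ρ.toLocal v σ * Q).val 1 1 ^ m = 1 ∧
            (Q⁻¹ * ρ.toLocal v σ * Q).val 0 0 ^ m =
              algebraMap (Padic p) (PadicAlgCl p)
                (((GaloisRep.cyclotomicCharacter (v.adicCompletion F) p σ).val : PadicInt p) :
                  Padic p) ^ ((k - 1) * m))) →
    ¬ InBMRange F p O ρ₀ →
    ∃ (𝒰 : TameLevel 2 F p) (r : FramedGaloisRep F (PadicAlgCl p) 2)
      (r₀ : absoluteGaloisGroup F →* Matrix.GeneralLinearGroup (Fin 2) O)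
      (q : HeightOneSpectrum (𝓞 F)),
      r.toGaloisRep.IsIrreducible ∧ 𝒰.IsPadicallyAutomorphic r ∧
      r.HasUpperTriangularIntegralModel r₀ ∧
      (∀ g, ((r₀ g).val 0 0 - (ρ₀ g).val 0 0 : O) ∈ maximalIdeal O ∧
        ((r₀ g).val 1 1 - (ρ₀ g).val 1 1 : O) ∈ maximalIdeal O) ∧
      (∃ k : ℕ, 2 ≤ k ∧ ∃ m : ℕ, 0 < m ∧ ∀ v : HeightOneSpectrum (𝓞 F), (p : 𝓞 F) ∈ v.asIdeal →
        ∃ Q : Matrix.GeneralLinearGroup (Fin 2) (PadicAlgCl p),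
          Valued.v (Q.val 0 0) ≤ Valued.v (Q.val 1 0) ∧
          ∀ σ, (Q⁻¹ * r.toLocal v σ * Q).val 1 0 = 0 ∧
            (σ ∈ absInertia (v.adicCompletion F) →
              (Q⁻¹ * r.toLocal v σ * Q).val 1 1 ^ m = 1 ∧
              (Q⁻¹ * r.toLocal v σ * Q).val 0 0 ^ m =
                algebraMap (Padic p) (PadicAlgCl p)
                  (((GaloisRep.cyclotomicCharacter (v.adicCompletion F) p σ).val : PadicInt p) :
                    Padic p) ^ ((k - 1) * m))) ∧
      (∀ v : HeightOneSpectrum (𝓞 F), v ≠ q → (p : 𝓞 F) ∉ v.asIdeal →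
        (∀ 𝔓 ∈ v.primesAbove, ∀ σ ∈ 𝔓.inertia (absoluteGaloisGroup F),
          ((ρ₀ σ).val 0 0 - 1 : O) ∈ maximalIdeal O ∧ ((ρ₀ σ).val 1 1 - 1 : O) ∈ maximalIdeal O) →
        v ∉ 𝒰.bad)

/-! ## 2. The six registered stubs (the only `sorry`s of the line; statements = §1 verbatim, FULLY QUALIFIED, so that
a Theorems-side `--supports stmt-Langlands-12920` proof can restate them textually without importing this file) -/

/-- **stub_inertBMPrimeSupply** — registered form (statement = `S.stub_inertBMPrimeSupply`).
[S (paper) / M (Lean): Dirichlet + parity + class field theory over `ℚ`; PROVABLE NOW.] -/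
theorem stub_inertBMPrimeSupply :
    ∀ (F : Type) [Field F] [NumberField F], NumberField.IsTotallyComplex F → Module.finrank ℚ F = 2 →
      ∀ (p : ℕ) [Fact p.Prime], 5 ≤ p →
      ∀ (η : Field.absoluteGaloisGroup ℚ →ₜ* (PadicAlgCl p)ˣ),
      (∀ τ, Valued.v ((η τ : (PadicAlgCl p)ˣ) : PadicAlgCl p) = 1) →
      (∀ c : Field.absoluteGaloisGroup ℚ, Literature.NumberTheory.GaloisRepresentations.IsComplexConjugation (Rat.castHom ℝ) c →
        Valued.v (((η c : (PadicAlgCl p)ˣ) : PadicAlgCl p) + 1) < 1) →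
      ¬ ((∀ τ, Valued.v (((η τ : (PadicAlgCl p)ˣ) : PadicAlgCl p) - (algebraMap (Padic p) (PadicAlgCl p) (((Literature.NumberTheory.GaloisRepresentations.GaloisRep.cyclotomicCharacter ℚ p τ).val : PadicInt p) : Padic p))) < 1) ∧
          p % 4 = 3 ∧ ∃ x : F, x ^ 2 = -(p : F)) →
      ∃ M : ℕ, M.Prime ∧ M ≠ p ∧ (Ideal.span {(M : NumberField.RingOfIntegers F)}).IsPrime ∧
        (∀ w : IsDedekindDomain.HeightOneSpectrum (NumberField.RingOfIntegers ℚ), (M : NumberField.RingOfIntegers ℚ) ∈ w.asIdeal → ∀ 𝔓 ∈ w.primesAbove,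
          ∀ σ ∈ 𝔓.inertia (Field.absoluteGaloisGroup ℚ),
            Valued.v (((η σ : (PadicAlgCl p)ˣ) : PadicAlgCl p) - 1) < 1) ∧
        (∀ w : IsDedekindDomain.HeightOneSpectrum (NumberField.RingOfIntegers ℚ), (M : NumberField.RingOfIntegers ℚ) ∈ w.asIdeal → ∀ 𝔓 ∈ w.primesAbove,
          ∀ σ : Field.absoluteGaloisGroup ℚ, IsArithFrobAt (NumberField.RingOfIntegers ℚ) σ 𝔓 →
            Valued.v (((η σ : (PadicAlgCl p)ˣ) : PadicAlgCl p) * (M : PadicAlgCl p) - 1) < 1) ∧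
        ((∀ τ, Valued.v (((η τ : (PadicAlgCl p)ˣ) : PadicAlgCl p) - (algebraMap (Padic p) (PadicAlgCl p) (((Literature.NumberTheory.GaloisRepresentations.GaloisRep.cyclotomicCharacter ℚ p τ).val : PadicInt p) : Padic p))) < 1) → M % p = 1) := by
  sorry

/-- **stub_levelRaisedEisensteinNewformQ** — registered form (statement = `S.stub_levelRaisedEisensteinNewformQ`).
[L–XL; BM Thm 2 + Carayol + Deligne + Ribet + Fontaine–Edixhoven; theorem-grade in print.] -/
theorem stub_levelRaisedEisensteinNewformQ :
    ∀ (p : ℕ) [Fact p.Prime], 5 ≤ p → ∀ (O : ValuationSubring (PadicAlgCl p)),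
      O = (Valued.v : Valuation (PadicAlgCl p) NNReal).valuationSubring →
      ∀ (η : Field.absoluteGaloisGroup ℚ →ₜ* (PadicAlgCl p)ˣ) (M : ℕ),
      (∀ τ, Valued.v ((η τ : (PadicAlgCl p)ˣ) : PadicAlgCl p) = 1) →
      (∀ c : Field.absoluteGaloisGroup ℚ, Literature.NumberTheory.GaloisRepresentations.IsComplexConjugation (Rat.castHom ℝ) c →
        Valued.v (((η c : (PadicAlgCl p)ˣ) : PadicAlgCl p) + 1) < 1) →
      (∀ w : IsDedekindDomain.HeightOneSpectrum (NumberField.RingOfIntegers ℚ), (p : NumberField.RingOfIntegers ℚ) ∈ w.asIdeal → ∀ 𝔓 ∈ w.primesAbove,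
        (∃ σ ∈ 𝔓.inertia (Field.absoluteGaloisGroup ℚ),
          ¬ Valued.v (((η σ : (PadicAlgCl p)ˣ) : PadicAlgCl p) - 1) < 1) ∧
        (∃ σ ∈ 𝔓.inertia (Field.absoluteGaloisGroup ℚ),
          ¬ Valued.v (((η σ : (PadicAlgCl p)ˣ) : PadicAlgCl p) * (algebraMap (Padic p) (PadicAlgCl p) (((Literature.NumberTheory.GaloisRepresentations.GaloisRep.cyclotomicCharacter ℚ p σ).val : PadicInt p) : Padic p)) - 1) < 1)) →
      M.Prime → M ≠ p →
      (∀ w : IsDedekindDomain.HeightOneSpectrum (NumberField.RingOfIntegers ℚ), (M : NumberField.RingOfIntegers ℚ) ∈ w.asIdeal → ∀ 𝔓 ∈ w.primesAbove,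
        ∀ σ ∈ 𝔓.inertia (Field.absoluteGaloisGroup ℚ),
          Valued.v (((η σ : (PadicAlgCl p)ˣ) : PadicAlgCl p) - 1) < 1) →
      (∀ w : IsDedekindDomain.HeightOneSpectrum (NumberField.RingOfIntegers ℚ), (M : NumberField.RingOfIntegers ℚ) ∈ w.asIdeal → ∀ 𝔓 ∈ w.primesAbove,
        ∀ σ : Field.absoluteGaloisGroup ℚ, IsArithFrobAt (NumberField.RingOfIntegers ℚ) σ 𝔓 →
          Valued.v (((η σ : (PadicAlgCl p)ˣ) : PadicAlgCl p) * (M : PadicAlgCl p) - 1) < 1) →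
      ((∀ τ, Valued.v (((η τ : (PadicAlgCl p)ˣ) : PadicAlgCl p) - (algebraMap (Padic p) (PadicAlgCl p) (((Literature.NumberTheory.GaloisRepresentations.GaloisRep.cyclotomicCharacter ℚ p τ).val : PadicInt p) : Padic p))) < 1) → M % p = 1) →
      ∃ (k : ℕ) (ρ' : Literature.NumberTheory.GaloisRepresentations.FramedGaloisRep ℚ (PadicAlgCl p) 2)
        (ρ'₀ : Field.absoluteGaloisGroup ℚ →* Matrix.GeneralLinearGroup (Fin 2) O),
        2 ≤ k ∧ ρ'.toGaloisRep.IsIrreducible ∧ ρ'.HasUpperTriangularIntegralModel ρ'₀ ∧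
        (∀ g, ((ρ'₀ g).val 0 0 - 1 : O) ∈ IsLocalRing.maximalIdeal O ∧
          Valued.v (((ρ'₀ g).val 1 1 : PadicAlgCl p) - ((η g : (PadicAlgCl p)ˣ) : PadicAlgCl p)) < 1) ∧
        (∀ w : IsDedekindDomain.HeightOneSpectrum (NumberField.RingOfIntegers ℚ), (p : NumberField.RingOfIntegers ℚ) ∈ w.asIdeal →
          ∃ Q : Matrix.GeneralLinearGroup (Fin 2) (PadicAlgCl p),
            Valued.v (Q.val 0 0) ≤ Valued.v (Q.val 1 0) ∧
            ∀ σ, (Q⁻¹ * ρ'.toLocal w σ * Q).val 1 0 = 0 ∧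
              (σ ∈ Literature.NumberTheory.GaloisRepresentations.absInertia (w.adicCompletion ℚ) →
                (Q⁻¹ * ρ'.toLocal w σ * Q).val 1 1 = 1 ∧
                (Q⁻¹ * ρ'.toLocal w σ * Q).val 0 0 =
                  algebraMap (Padic p) (PadicAlgCl p)
                    (((Literature.NumberTheory.GaloisRepresentations.GaloisRep.cyclotomicCharacter (w.adicCompletion ℚ) p σ).val : PadicInt p) :
                      Padic p) ^ (k - 1))) ∧
        (∀ w : IsDedekindDomain.HeightOneSpectrum (NumberField.RingOfIntegers ℚ), (M : NumberField.RingOfIntegers ℚ) ∉ w.asIdeal → (p : NumberField.RingOfIntegers ℚ) ∉ w.asIdeal →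
          ∀ 𝔓 ∈ w.primesAbove, ∀ σ ∈ 𝔓.inertia (Field.absoluteGaloisGroup ℚ),
            Valued.v (((η σ : (PadicAlgCl p)ˣ) : PadicAlgCl p) - 1) < 1 → ρ' σ = 1) ∧
        ∀ hcpt : Literature.NumberTheory.Automorphic.isCompact_glFiniteIntegralLevel 2 ℚ,
          ∃ (ι : PadicAlgCl p ≃+* ℂ) (π : Literature.NumberTheory.Automorphic.CuspidalAutomorphicRepData 2 ℚ hcpt) (T : Literature.NumberTheory.Automorphic.InfinityType ℚ 2),
            π.1.HasInfinityType T ∧ T.IsLAlgebraic ∧ T.IsRegular ∧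
            ∀ᶠ w in Filter.cofinite, Summit.Langlands.SatakeFrobCompatibleAt ι π.1 ρ' w := by
  sorry

/-- **stub_restrictTwistGaloisPackage** — registered form (statement = `S.stub_restrictTwistGaloisPackage`).
[L (Lean); Galois bookkeeping; PROVABLE NOW.] -/
theorem stub_restrictTwistGaloisPackage :
    ∀ (F : Type) [Field F] [NumberField F], NumberField.IsTotallyComplex F → Module.finrank ℚ F = 2 →
      ∀ (p : ℕ) [Fact p.Prime] (O : ValuationSubring (PadicAlgCl p)),
      O = (Valued.v : Valuation (PadicAlgCl p) NNReal).valuationSubring →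
      ∀ (ρ : Literature.NumberTheory.GaloisRepresentations.FramedGaloisRep F (PadicAlgCl p) 2)
        (ρ₀ : Field.absoluteGaloisGroup F →* Matrix.GeneralLinearGroup (Fin 2) O),
      (∀ᶠ v in Filter.cofinite, ρ.IsUnramifiedAt v) → ρ.HasUpperTriangularIntegralModel ρ₀ →
      (∀ v : IsDedekindDomain.HeightOneSpectrum (NumberField.RingOfIntegers F), (p : NumberField.RingOfIntegers F) ∈ v.asIdeal → Literature.NumberTheory.GaloisRepresentations.IsPDistinguishedAt ρ₀ v) →
      ∀ (η : Field.absoluteGaloisGroup ℚ →ₜ* (PadicAlgCl p)ˣ) (M k : ℕ)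
        (ρ' : Literature.NumberTheory.GaloisRepresentations.FramedGaloisRep ℚ (PadicAlgCl p) 2)
        (ρ'₀ : Field.absoluteGaloisGroup ℚ →* Matrix.GeneralLinearGroup (Fin 2) O),
      (∀ τ, Valued.v ((η τ : (PadicAlgCl p)ˣ) : PadicAlgCl p) = 1) →
      (∀ σ : Field.absoluteGaloisGroup F,
        Valued.v (((η (Literature.NumberTheory.GaloisRepresentations.absGaloisRestrict ℚ F σ) : (PadicAlgCl p)ˣ) : PadicAlgCl p) *
            ((ρ₀ σ).val 0 0 : PadicAlgCl p) - ((ρ₀ σ).val 1 1 : PadicAlgCl p)) < 1) →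
      M.Prime → (Ideal.span {(M : NumberField.RingOfIntegers F)}).IsPrime → 2 ≤ k →
      ρ'.toGaloisRep.IsIrreducible → ρ'.HasUpperTriangularIntegralModel ρ'₀ →
      (∀ g, ((ρ'₀ g).val 0 0 - 1 : O) ∈ IsLocalRing.maximalIdeal O ∧
        Valued.v (((ρ'₀ g).val 1 1 : PadicAlgCl p) - ((η g : (PadicAlgCl p)ˣ) : PadicAlgCl p)) < 1) →
      (∀ w : IsDedekindDomain.HeightOneSpectrum (NumberField.RingOfIntegers ℚ), (p : NumberField.RingOfIntegers ℚ) ∈ w.asIdeal →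
        ∃ Q : Matrix.GeneralLinearGroup (Fin 2) (PadicAlgCl p),
          Valued.v (Q.val 0 0) ≤ Valued.v (Q.val 1 0) ∧
          ∀ σ, (Q⁻¹ * ρ'.toLocal w σ * Q).val 1 0 = 0 ∧
            (σ ∈ Literature.NumberTheory.GaloisRepresentations.absInertia (w.adicCompletion ℚ) →
              (Q⁻¹ * ρ'.toLocal w σ * Q).val 1 1 = 1 ∧
              (Q⁻¹ * ρ'.toLocal w σ * Q).val 0 0 =
                algebraMap (Padic p) (PadicAlgCl p)
                  (((Literature.NumberTheory.GaloisRepresentations.GaloisRep.cyclotomicCharacter (w.adicCompletion ℚ) p σ).val : PadicInt p) :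
                    Padic p) ^ (k - 1))) →
      (∀ w : IsDedekindDomain.HeightOneSpectrum (NumberField.RingOfIntegers ℚ), (M : NumberField.RingOfIntegers ℚ) ∉ w.asIdeal → (p : NumberField.RingOfIntegers ℚ) ∉ w.asIdeal →
        ∀ 𝔓 ∈ w.primesAbove, ∀ σ ∈ 𝔓.inertia (Field.absoluteGaloisGroup ℚ),
          Valued.v (((η σ : (PadicAlgCl p)ˣ) : PadicAlgCl p) - 1) < 1 → ρ' σ = 1) →
      ∃ (r : Literature.NumberTheory.GaloisRepresentations.FramedGaloisRep F (PadicAlgCl p) 2)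
        (r₀ : Field.absoluteGaloisGroup F →* Matrix.GeneralLinearGroup (Fin 2) O)
        (ν : Field.absoluteGaloisGroup F →ₜ* (PadicAlgCl p)ˣ) (q : IsDedekindDomain.HeightOneSpectrum (NumberField.RingOfIntegers F))
        (S : Set (IsDedekindDomain.HeightOneSpectrum (NumberField.RingOfIntegers F))),
        (∃ n : ℕ, 0 < n ∧ ∀ σ, ν σ ^ n = 1) ∧
        (∀ σ, (r σ).val = ((ν σ : (PadicAlgCl p)ˣ) : PadicAlgCl p) • (ρ' (Literature.NumberTheory.GaloisRepresentations.absGaloisRestrict ℚ F σ)).val) ∧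
        r.toGaloisRep.IsIrreducible ∧ r.HasUpperTriangularIntegralModel r₀ ∧
        (∀ g, ((r₀ g).val 0 0 - (ρ₀ g).val 0 0 : O) ∈ IsLocalRing.maximalIdeal O ∧
          ((r₀ g).val 1 1 - (ρ₀ g).val 1 1 : O) ∈ IsLocalRing.maximalIdeal O) ∧
        (∃ k' : ℕ, 2 ≤ k' ∧ ∃ m : ℕ, 0 < m ∧ ∀ v : IsDedekindDomain.HeightOneSpectrum (NumberField.RingOfIntegers F), (p : NumberField.RingOfIntegers F) ∈ v.asIdeal →
          ∃ Q : Matrix.GeneralLinearGroup (Fin 2) (PadicAlgCl p),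
            Valued.v (Q.val 0 0) ≤ Valued.v (Q.val 1 0) ∧
            ∀ σ, (Q⁻¹ * r.toLocal v σ * Q).val 1 0 = 0 ∧
              (σ ∈ Literature.NumberTheory.GaloisRepresentations.absInertia (v.adicCompletion F) →
                (Q⁻¹ * r.toLocal v σ * Q).val 1 1 ^ m = 1 ∧
                (Q⁻¹ * r.toLocal v σ * Q).val 0 0 ^ m =
                  algebraMap (Padic p) (PadicAlgCl p)
                    (((Literature.NumberTheory.GaloisRepresentations.GaloisRep.cyclotomicCharacter (v.adicCompletion F) p σ).val : PadicInt p) :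
                      Padic p) ^ ((k' - 1) * m))) ∧
        S.Finite ∧ (∀ v : IsDedekindDomain.HeightOneSpectrum (NumberField.RingOfIntegers F), (p : NumberField.RingOfIntegers F) ∈ v.asIdeal → v ∈ S) ∧
        (∀ v ∉ S, r.IsUnramifiedAt v) ∧
        (∀ v : IsDedekindDomain.HeightOneSpectrum (NumberField.RingOfIntegers F), v ≠ q → (p : NumberField.RingOfIntegers F) ∉ v.asIdeal →
          (∀ 𝔓 ∈ v.primesAbove, ∀ σ ∈ 𝔓.inertia (Field.absoluteGaloisGroup F),
            ((ρ₀ σ).val 0 0 - 1 : O) ∈ IsLocalRing.maximalIdeal O ∧ ((ρ₀ σ).val 1 1 - 1 : O) ∈ IsLocalRing.maximalIdeal O) →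
          v ∉ S) := by
  sorry

/-- **stub_quadraticBaseChangeTwist** — registered form (statement = `S.stub_quadraticBaseChangeTwist`).
[XL; Langlands quadratic base change with LGC off `p`; theorem-grade in print.] -/
theorem stub_quadraticBaseChangeTwist :
    ∀ (F : Type) [Field F] [NumberField F], NumberField.IsTotallyComplex F → Module.finrank ℚ F = 2 →
      ∀ (p : ℕ) [Fact p.Prime] (hcptQ : Literature.NumberTheory.Automorphic.isCompact_glFiniteIntegralLevel 2 ℚ) (ι : PadicAlgCl p ≃+* ℂ)
        (π : Literature.NumberTheory.Automorphic.CuspidalAutomorphicRepData 2 ℚ hcptQ) (T : Literature.NumberTheory.Automorphic.InfinityType ℚ 2),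
      π.1.HasInfinityType T → T.IsLAlgebraic → T.IsRegular →
      ∀ (ρ' : Literature.NumberTheory.GaloisRepresentations.FramedGaloisRep ℚ (PadicAlgCl p) 2),
      (∀ᶠ w in Filter.cofinite, Summit.Langlands.SatakeFrobCompatibleAt ι π.1 ρ' w) →
      ∀ (ν : Field.absoluteGaloisGroup F →ₜ* (PadicAlgCl p)ˣ), (∃ n : ℕ, 0 < n ∧ ∀ σ, ν σ ^ n = 1) →
      ∀ (r : Literature.NumberTheory.GaloisRepresentations.FramedGaloisRep F (PadicAlgCl p) 2),
      (∀ σ, (r σ).val = ((ν σ : (PadicAlgCl p)ˣ) : PadicAlgCl p) • (ρ' (Literature.NumberTheory.GaloisRepresentations.absGaloisRestrict ℚ F σ)).val) →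
      r.toGaloisRep.IsIrreducible →
      ∀ (S : Set (IsDedekindDomain.HeightOneSpectrum (NumberField.RingOfIntegers F))), S.Finite →
      (∀ v : IsDedekindDomain.HeightOneSpectrum (NumberField.RingOfIntegers F), (p : NumberField.RingOfIntegers F) ∈ v.asIdeal → v ∈ S) →
      (∀ v ∉ S, r.IsUnramifiedAt v) →
      ∀ hcptF : Literature.NumberTheory.Automorphic.isCompact_glFiniteIntegralLevel 2 F,
        ∃ (πF : Literature.NumberTheory.Automorphic.CuspidalAutomorphicRepData 2 F hcptF) (T' : Literature.NumberTheory.Automorphic.InfinityType F 2),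
          πF.1.HasInfinityType T' ∧ T'.IsLAlgebraic ∧ T'.IsRegular ∧
          ∀ v ∉ S, Summit.Langlands.SatakeFrobCompatibleAt ι πF.1 r v := by
  sorry

/-- **stub_cuspidalCohomologicalPoint** — registered form (statement = `S.stub_cuspidalCohomologicalPoint`).
[L–XL; the dictionary D1 (Eichler–Shimura–Harder + completed cohomology); theorem-grade in print.] -/
theorem stub_cuspidalCohomologicalPoint :
    ∀ (F : Type) [Field F] [NumberField F], NumberField.IsTotallyComplex F → Module.finrank ℚ F = 2 →
      ∀ (p : ℕ) [Fact p.Prime] (hcpt : Literature.NumberTheory.Automorphic.isCompact_glFiniteIntegralLevel 2 F) (ι : PadicAlgCl p ≃+* ℂ)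
        (πF : Literature.NumberTheory.Automorphic.CuspidalAutomorphicRepData 2 F hcpt) (T : Literature.NumberTheory.Automorphic.InfinityType F 2),
      πF.1.HasInfinityType T → T.IsLAlgebraic → T.IsRegular →
      ∀ (S : Set (IsDedekindDomain.HeightOneSpectrum (NumberField.RingOfIntegers F))), S.Finite →
      (∀ v : IsDedekindDomain.HeightOneSpectrum (NumberField.RingOfIntegers F), (p : NumberField.RingOfIntegers F) ∈ v.asIdeal → v ∈ S) →
      ∀ (r : Literature.NumberTheory.GaloisRepresentations.FramedGaloisRep F (PadicAlgCl p) 2),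
      (∀ v ∉ S, Summit.Langlands.SatakeFrobCompatibleAt ι πF.1 r v) →
      ∃ 𝒰 : Literature.NumberTheory.Automorphic.BigHeckeGLn.TameLevel 2 F p, 𝒰.bad = S ∧ 𝒰.IsPadicallyAutomorphic r := by
  sorry

/-- **stub_complementRegimeSeed** — the CONCEDED COMPLEMENT, registered form (statement =
`S.stub_complementRegimeSeed`). [open problem; not a lemma of this line — see the def's docstring.] -/
theorem stub_complementRegimeSeed :
    ∀ (F : Type) [Field F] [NumberField F], NumberField.IsTotallyComplex F → Module.finrank ℚ F = 2 →
      ∀ (p : ℕ) [Fact p.Prime], p ≠ 2 → ∀ (O : ValuationSubring (PadicAlgCl p)),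
      O = (Valued.v : Valuation (PadicAlgCl p) NNReal).valuationSubring →
      ∀ (ρ : Literature.NumberTheory.GaloisRepresentations.FramedGaloisRep F (PadicAlgCl p) 2)
        (ρ₀ : Field.absoluteGaloisGroup F →* Matrix.GeneralLinearGroup (Fin 2) O),
      ρ.toGaloisRep.IsIrreducible → (∀ᶠ v in Filter.cofinite, ρ.IsUnramifiedAt v) →
      ρ.HasUpperTriangularIntegralModel ρ₀ →
      (∃ k : ℕ, 2 ≤ k ∧ ∃ m : ℕ, 0 < m ∧ ∀ v : IsDedekindDomain.HeightOneSpectrum (NumberField.RingOfIntegers F), (p : NumberField.RingOfIntegers F) ∈ v.asIdeal →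
        Literature.NumberTheory.GaloisRepresentations.IsPDistinguishedAt ρ₀ v ∧ ∃ Q : Matrix.GeneralLinearGroup (Fin 2) (PadicAlgCl p),
          Valued.v (Q.val 0 0) ≤ Valued.v (Q.val 1 0) ∧
          ∀ σ, (Q⁻¹ * ρ.toLocal v σ * Q).val 1 0 = 0 ∧
            (σ ∈ Literature.NumberTheory.GaloisRepresentations.absInertia (v.adicCompletion F) →
              (Q⁻¹ * ρ.toLocal v σ * Q).val 1 1 ^ m = 1 ∧
              (Q⁻¹ * ρ.toLocal v σ * Q).val 0 0 ^ m =
                algebraMap (Padic p) (PadicAlgCl p)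
                  (((Literature.NumberTheory.GaloisRepresentations.GaloisRep.cyclotomicCharacter (v.adicCompletion F) p σ).val : PadicInt p) :
                    Padic p) ^ ((k - 1) * m))) →
      ¬ (5 ≤ p ∧ ∃ η : Field.absoluteGaloisGroup ℚ →ₜ* (PadicAlgCl p)ˣ,
      (∀ τ, Valued.v ((η τ : (PadicAlgCl p)ˣ) : PadicAlgCl p) = 1) ∧
      (∀ σ : Field.absoluteGaloisGroup F,
        Valued.v (((η (Literature.NumberTheory.GaloisRepresentations.absGaloisRestrict ℚ F σ) : (PadicAlgCl p)ˣ) : PadicAlgCl p) *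
            ((ρ₀ σ).val 0 0 : PadicAlgCl p) - ((ρ₀ σ).val 1 1 : PadicAlgCl p)) < 1) ∧
      (∀ c : Field.absoluteGaloisGroup ℚ, Literature.NumberTheory.GaloisRepresentations.IsComplexConjugation (Rat.castHom ℝ) c →
        Valued.v (((η c : (PadicAlgCl p)ˣ) : PadicAlgCl p) + 1) < 1) ∧
      (∀ w : IsDedekindDomain.HeightOneSpectrum (NumberField.RingOfIntegers ℚ), (p : NumberField.RingOfIntegers ℚ) ∈ w.asIdeal → ∀ 𝔓 ∈ w.primesAbove,
        (∃ σ ∈ 𝔓.inertia (Field.absoluteGaloisGroup ℚ),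
          ¬ Valued.v (((η σ : (PadicAlgCl p)ˣ) : PadicAlgCl p) - 1) < 1) ∧
        (∃ σ ∈ 𝔓.inertia (Field.absoluteGaloisGroup ℚ),
          ¬ Valued.v (((η σ : (PadicAlgCl p)ˣ) : PadicAlgCl p) * (algebraMap (Padic p) (PadicAlgCl p) (((Literature.NumberTheory.GaloisRepresentations.GaloisRep.cyclotomicCharacter ℚ p σ).val : PadicInt p) : Padic p)) - 1) < 1)) ∧
      ¬ ((∀ τ, Valued.v (((η τ : (PadicAlgCl p)ˣ) : PadicAlgCl p) - (algebraMap (Padic p) (PadicAlgCl p) (((Literature.NumberTheory.GaloisRepresentations.GaloisRep.cyclotomicCharacter ℚ p τ).val : PadicInt p) : Padic p))) < 1) ∧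
          p % 4 = 3 ∧ ∃ x : F, x ^ 2 = -(p : F))) →
      ∃ (𝒰 : Literature.NumberTheory.Automorphic.BigHeckeGLn.TameLevel 2 F p) (r : Literature.NumberTheory.GaloisRepresentations.FramedGaloisRep F (PadicAlgCl p) 2)
        (r₀ : Field.absoluteGaloisGroup F →* Matrix.GeneralLinearGroup (Fin 2) O)
        (q : IsDedekindDomain.HeightOneSpectrum (NumberField.RingOfIntegers F)),
        r.toGaloisRep.IsIrreducible ∧ 𝒰.IsPadicallyAutomorphic r ∧
        r.HasUpperTriangularIntegralModel r₀ ∧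
        (∀ g, ((r₀ g).val 0 0 - (ρ₀ g).val 0 0 : O) ∈ IsLocalRing.maximalIdeal O ∧
          ((r₀ g).val 1 1 - (ρ₀ g).val 1 1 : O) ∈ IsLocalRing.maximalIdeal O) ∧
        (∃ k : ℕ, 2 ≤ k ∧ ∃ m : ℕ, 0 < m ∧ ∀ v : IsDedekindDomain.HeightOneSpectrum (NumberField.RingOfIntegers F), (p : NumberField.RingOfIntegers F) ∈ v.asIdeal →
          ∃ Q : Matrix.GeneralLinearGroup (Fin 2) (PadicAlgCl p),
            Valued.v (Q.val 0 0) ≤ Valued.v (Q.val 1 0) ∧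
            ∀ σ, (Q⁻¹ * r.toLocal v σ * Q).val 1 0 = 0 ∧
              (σ ∈ Literature.NumberTheory.GaloisRepresentations.absInertia (v.adicCompletion F) →
                (Q⁻¹ * r.toLocal v σ * Q).val 1 1 ^ m = 1 ∧
                (Q⁻¹ * r.toLocal v σ * Q).val 0 0 ^ m =
                  algebraMap (Padic p) (PadicAlgCl p)
                    (((Literature.NumberTheory.GaloisRepresentations.GaloisRep.cyclotomicCharacter (v.adicCompletion F) p σ).val : PadicInt p) :
                      Padic p) ^ ((k - 1) * m))) ∧
        (∀ v : IsDedekindDomain.HeightOneSpectrum (NumberField.RingOfIntegers F), v ≠ q → (p : NumberField.RingOfIntegers F) ∉ v.asIdeal →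
          (∀ 𝔓 ∈ v.primesAbove, ∀ σ ∈ 𝔓.inertia (Field.absoluteGaloisGroup F),
            ((ρ₀ σ).val 0 0 - 1 : O) ∈ IsLocalRing.maximalIdeal O ∧ ((ρ₀ σ).val 1 1 - 1 : O) ∈ IsLocalRing.maximalIdeal O) →
          v ∉ 𝒰.bad) := by
  sorry

/-! ## 3. Sanity lemmas (proved): the registered forms ARE the `S.stub_*` statements; the regime is decidable data on
the residual pair; on the BM range the seed follows from `(hunr, hmod, p-distinguishedness)` alone -/

theorem stub_inertBMPrimeSupply_iff :
    S.stub_inertBMPrimeSupply ↔ (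
    ∀ (F : Type) [Field F] [NumberField F], NumberField.IsTotallyComplex F → Module.finrank ℚ F = 2 →
      ∀ (p : ℕ) [Fact p.Prime], 5 ≤ p →
      ∀ (η : Field.absoluteGaloisGroup ℚ →ₜ* (PadicAlgCl p)ˣ),
      (∀ τ, Valued.v ((η τ : (PadicAlgCl p)ˣ) : PadicAlgCl p) = 1) →
      (∀ c : Field.absoluteGaloisGroup ℚ, Literature.NumberTheory.GaloisRepresentations.IsComplexConjugation (Rat.castHom ℝ) c →
        Valued.v (((η c : (PadicAlgCl p)ˣ) : PadicAlgCl p) + 1) < 1) →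
      ¬ ((∀ τ, Valued.v (((η τ : (PadicAlgCl p)ˣ) : PadicAlgCl p) - (algebraMap (Padic p) (PadicAlgCl p) (((Literature.NumberTheory.GaloisRepresentations.GaloisRep.cyclotomicCharacter ℚ p τ).val : PadicInt p) : Padic p))) < 1) ∧
          p % 4 = 3 ∧ ∃ x : F, x ^ 2 = -(p : F)) →
      ∃ M : ℕ, M.Prime ∧ M ≠ p ∧ (Ideal.span {(M : NumberField.RingOfIntegers F)}).IsPrime ∧
        (∀ w : IsDedekindDomain.HeightOneSpectrum (NumberField.RingOfIntegers ℚ), (M : NumberField.RingOfIntegers ℚ) ∈ w.asIdeal → ∀ 𝔓 ∈ w.primesAbove,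
          ∀ σ ∈ 𝔓.inertia (Field.absoluteGaloisGroup ℚ),
            Valued.v (((η σ : (PadicAlgCl p)ˣ) : PadicAlgCl p) - 1) < 1) ∧
        (∀ w : IsDedekindDomain.HeightOneSpectrum (NumberField.RingOfIntegers ℚ), (M : NumberField.RingOfIntegers ℚ) ∈ w.asIdeal → ∀ 𝔓 ∈ w.primesAbove,
          ∀ σ : Field.absoluteGaloisGroup ℚ, IsArithFrobAt (NumberField.RingOfIntegers ℚ) σ 𝔓 →
            Valued.v (((η σ : (PadicAlgCl p)ˣ) : PadicAlgCl p) * (M : PadicAlgCl p) - 1) < 1) ∧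
        ((∀ τ, Valued.v (((η τ : (PadicAlgCl p)ˣ) : PadicAlgCl p) - (algebraMap (Padic p) (PadicAlgCl p) (((Literature.NumberTheory.GaloisRepresentations.GaloisRep.cyclotomicCharacter ℚ p τ).val : PadicInt p) : Padic p))) < 1) → M % p = 1) ) :=
  Iff.rfl

theorem stub_levelRaisedEisensteinNewformQ_iff :
    S.stub_levelRaisedEisensteinNewformQ ↔ (
    ∀ (p : ℕ) [Fact p.Prime], 5 ≤ p → ∀ (O : ValuationSubring (PadicAlgCl p)),
      O = (Valued.v : Valuation (PadicAlgCl p) NNReal).valuationSubring →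
      ∀ (η : Field.absoluteGaloisGroup ℚ →ₜ* (PadicAlgCl p)ˣ) (M : ℕ),
      (∀ τ, Valued.v ((η τ : (PadicAlgCl p)ˣ) : PadicAlgCl p) = 1) →
      (∀ c : Field.absoluteGaloisGroup ℚ, Literature.NumberTheory.GaloisRepresentations.IsComplexConjugation (Rat.castHom ℝ) c →
        Valued.v (((η c : (PadicAlgCl p)ˣ) : PadicAlgCl p) + 1) < 1) →
      (∀ w : IsDedekindDomain.HeightOneSpectrum (NumberField.RingOfIntegers ℚ), (p : NumberField.RingOfIntegers ℚ) ∈ w.asIdeal → ∀ 𝔓 ∈ w.primesAbove,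
        (∃ σ ∈ 𝔓.inertia (Field.absoluteGaloisGroup ℚ),
          ¬ Valued.v (((η σ : (PadicAlgCl p)ˣ) : PadicAlgCl p) - 1) < 1) ∧
        (∃ σ ∈ 𝔓.inertia (Field.absoluteGaloisGroup ℚ),
          ¬ Valued.v (((η σ : (PadicAlgCl p)ˣ) : PadicAlgCl p) * (algebraMap (Padic p) (PadicAlgCl p) (((Literature.NumberTheory.GaloisRepresentations.GaloisRep.cyclotomicCharacter ℚ p σ).val : PadicInt p) : Padic p)) - 1) < 1)) →
      M.Prime → M ≠ p →
      (∀ w : IsDedekindDomain.HeightOneSpectrum (NumberField.RingOfIntegers ℚ), (M : NumberField.RingOfIntegers ℚ) ∈ w.asIdeal → ∀ 𝔓 ∈ w.primesAbove,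
        ∀ σ ∈ 𝔓.inertia (Field.absoluteGaloisGroup ℚ),
          Valued.v (((η σ : (PadicAlgCl p)ˣ) : PadicAlgCl p) - 1) < 1) →
      (∀ w : IsDedekindDomain.HeightOneSpectrum (NumberField.RingOfIntegers ℚ), (M : NumberField.RingOfIntegers ℚ) ∈ w.asIdeal → ∀ 𝔓 ∈ w.primesAbove,
        ∀ σ : Field.absoluteGaloisGroup ℚ, IsArithFrobAt (NumberField.RingOfIntegers ℚ) σ 𝔓 →
          Valued.v (((η σ : (PadicAlgCl p)ˣ) : PadicAlgCl p) * (M : PadicAlgCl p) - 1) < 1) →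
      ((∀ τ, Valued.v (((η τ : (PadicAlgCl p)ˣ) : PadicAlgCl p) - (algebraMap (Padic p) (PadicAlgCl p) (((Literature.NumberTheory.GaloisRepresentations.GaloisRep.cyclotomicCharacter ℚ p τ).val : PadicInt p) : Padic p))) < 1) → M % p = 1) →
      ∃ (k : ℕ) (ρ' : Literature.NumberTheory.GaloisRepresentations.FramedGaloisRep ℚ (PadicAlgCl p) 2)
        (ρ'₀ : Field.absoluteGaloisGroup ℚ →* Matrix.GeneralLinearGroup (Fin 2) O),
        2 ≤ k ∧ ρ'.toGaloisRep.IsIrreducible ∧ ρ'.HasUpperTriangularIntegralModel ρ'₀ ∧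
        (∀ g, ((ρ'₀ g).val 0 0 - 1 : O) ∈ IsLocalRing.maximalIdeal O ∧
          Valued.v (((ρ'₀ g).val 1 1 : PadicAlgCl p) - ((η g : (PadicAlgCl p)ˣ) : PadicAlgCl p)) < 1) ∧
        (∀ w : IsDedekindDomain.HeightOneSpectrum (NumberField.RingOfIntegers ℚ), (p : NumberField.RingOfIntegers ℚ) ∈ w.asIdeal →
          ∃ Q : Matrix.GeneralLinearGroup (Fin 2) (PadicAlgCl p),
            Valued.v (Q.val 0 0) ≤ Valued.v (Q.val 1 0) ∧
            ∀ σ, (Q⁻¹ * ρ'.toLocal w σ * Q).val 1 0 = 0 ∧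
              (σ ∈ Literature.NumberTheory.GaloisRepresentations.absInertia (w.adicCompletion ℚ) →
                (Q⁻¹ * ρ'.toLocal w σ * Q).val 1 1 = 1 ∧
                (Q⁻¹ * ρ'.toLocal w σ * Q).val 0 0 =
                  algebraMap (Padic p) (PadicAlgCl p)
                    (((Literature.NumberTheory.GaloisRepresentations.GaloisRep.cyclotomicCharacter (w.adicCompletion ℚ) p σ).val : PadicInt p) :
                      Padic p) ^ (k - 1))) ∧
        (∀ w : IsDedekindDomain.HeightOneSpectrum (NumberField.RingOfIntegers ℚ), (M : NumberField.RingOfIntegers ℚ) ∉ w.asIdeal → (p : NumberField.RingOfIntegers ℚ) ∉ w.asIdeal →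
          ∀ 𝔓 ∈ w.primesAbove, ∀ σ ∈ 𝔓.inertia (Field.absoluteGaloisGroup ℚ),
            Valued.v (((η σ : (PadicAlgCl p)ˣ) : PadicAlgCl p) - 1) < 1 → ρ' σ = 1) ∧
        ∀ hcpt : Literature.NumberTheory.Automorphic.isCompact_glFiniteIntegralLevel 2 ℚ,
          ∃ (ι : PadicAlgCl p ≃+* ℂ) (π : Literature.NumberTheory.Automorphic.CuspidalAutomorphicRepData 2 ℚ hcpt) (T : Literature.NumberTheory.Automorphic.InfinityType ℚ 2),
            π.1.HasInfinityType T ∧ T.IsLAlgebraic ∧ T.IsRegular ∧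
            ∀ᶠ w in Filter.cofinite, Summit.Langlands.SatakeFrobCompatibleAt ι π.1 ρ' w ) :=
  Iff.rfl

theorem stub_restrictTwistGaloisPackage_iff :
    S.stub_restrictTwistGaloisPackage ↔ (
    ∀ (F : Type) [Field F] [NumberField F], NumberField.IsTotallyComplex F → Module.finrank ℚ F = 2 →
      ∀ (p : ℕ) [Fact p.Prime] (O : ValuationSubring (PadicAlgCl p)),
      O = (Valued.v : Valuation (PadicAlgCl p) NNReal).valuationSubring →
      ∀ (ρ : Literature.NumberTheory.GaloisRepresentations.FramedGaloisRep F (PadicAlgCl p) 2)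
        (ρ₀ : Field.absoluteGaloisGroup F →* Matrix.GeneralLinearGroup (Fin 2) O),
      (∀ᶠ v in Filter.cofinite, ρ.IsUnramifiedAt v) → ρ.HasUpperTriangularIntegralModel ρ₀ →
      (∀ v : IsDedekindDomain.HeightOneSpectrum (NumberField.RingOfIntegers F), (p : NumberField.RingOfIntegers F) ∈ v.asIdeal → Literature.NumberTheory.GaloisRepresentations.IsPDistinguishedAt ρ₀ v) →
      ∀ (η : Field.absoluteGaloisGroup ℚ →ₜ* (PadicAlgCl p)ˣ) (M k : ℕ)
        (ρ' : Literature.NumberTheory.GaloisRepresentations.FramedGaloisRep ℚ (PadicAlgCl p) 2)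
        (ρ'₀ : Field.absoluteGaloisGroup ℚ →* Matrix.GeneralLinearGroup (Fin 2) O),
      (∀ τ, Valued.v ((η τ : (PadicAlgCl p)ˣ) : PadicAlgCl p) = 1) →
      (∀ σ : Field.absoluteGaloisGroup F,
        Valued.v (((η (Literature.NumberTheory.GaloisRepresentations.absGaloisRestrict ℚ F σ) : (PadicAlgCl p)ˣ) : PadicAlgCl p) *
            ((ρ₀ σ).val 0 0 : PadicAlgCl p) - ((ρ₀ σ).val 1 1 : PadicAlgCl p)) < 1) →
      M.Prime → (Ideal.span {(M : NumberField.RingOfIntegers F)}).IsPrime → 2 ≤ k →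
      ρ'.toGaloisRep.IsIrreducible → ρ'.HasUpperTriangularIntegralModel ρ'₀ →
      (∀ g, ((ρ'₀ g).val 0 0 - 1 : O) ∈ IsLocalRing.maximalIdeal O ∧
        Valued.v (((ρ'₀ g).val 1 1 : PadicAlgCl p) - ((η g : (PadicAlgCl p)ˣ) : PadicAlgCl p)) < 1) →
      (∀ w : IsDedekindDomain.HeightOneSpectrum (NumberField.RingOfIntegers ℚ), (p : NumberField.RingOfIntegers ℚ) ∈ w.asIdeal →
        ∃ Q : Matrix.GeneralLinearGroup (Fin 2) (PadicAlgCl p),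
          Valued.v (Q.val 0 0) ≤ Valued.v (Q.val 1 0) ∧
          ∀ σ, (Q⁻¹ * ρ'.toLocal w σ * Q).val 1 0 = 0 ∧
            (σ ∈ Literature.NumberTheory.GaloisRepresentations.absInertia (w.adicCompletion ℚ) →
              (Q⁻¹ * ρ'.toLocal w σ * Q).val 1 1 = 1 ∧
              (Q⁻¹ * ρ'.toLocal w σ * Q).val 0 0 =
                algebraMap (Padic p) (PadicAlgCl p)
                  (((Literature.NumberTheory.GaloisRepresentations.GaloisRep.cyclotomicCharacter (w.adicCompletion ℚ) p σ).val : PadicInt p) :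
                    Padic p) ^ (k - 1))) →
      (∀ w : IsDedekindDomain.HeightOneSpectrum (NumberField.RingOfIntegers ℚ), (M : NumberField.RingOfIntegers ℚ) ∉ w.asIdeal → (p : NumberField.RingOfIntegers ℚ) ∉ w.asIdeal →
        ∀ 𝔓 ∈ w.primesAbove, ∀ σ ∈ 𝔓.inertia (Field.absoluteGaloisGroup ℚ),
          Valued.v (((η σ : (PadicAlgCl p)ˣ) : PadicAlgCl p) - 1) < 1 → ρ' σ = 1) →
      ∃ (r : Literature.NumberTheory.GaloisRepresentations.FramedGaloisRep F (PadicAlgCl p) 2)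
        (r₀ : Field.absoluteGaloisGroup F →* Matrix.GeneralLinearGroup (Fin 2) O)
        (ν : Field.absoluteGaloisGroup F →ₜ* (PadicAlgCl p)ˣ) (q : IsDedekindDomain.HeightOneSpectrum (NumberField.RingOfIntegers F))
        (S : Set (IsDedekindDomain.HeightOneSpectrum (NumberField.RingOfIntegers F))),
        (∃ n : ℕ, 0 < n ∧ ∀ σ, ν σ ^ n = 1) ∧
        (∀ σ, (r σ).val = ((ν σ : (PadicAlgCl p)ˣ) : PadicAlgCl p) • (ρ' (Literature.NumberTheory.GaloisRepresentations.absGaloisRestrict ℚ F σ)).val) ∧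
        r.toGaloisRep.IsIrreducible ∧ r.HasUpperTriangularIntegralModel r₀ ∧
        (∀ g, ((r₀ g).val 0 0 - (ρ₀ g).val 0 0 : O) ∈ IsLocalRing.maximalIdeal O ∧
          ((r₀ g).val 1 1 - (ρ₀ g).val 1 1 : O) ∈ IsLocalRing.maximalIdeal O) ∧
        (∃ k' : ℕ, 2 ≤ k' ∧ ∃ m : ℕ, 0 < m ∧ ∀ v : IsDedekindDomain.HeightOneSpectrum (NumberField.RingOfIntegers F), (p : NumberField.RingOfIntegers F) ∈ v.asIdeal →
          ∃ Q : Matrix.GeneralLinearGroup (Fin 2) (PadicAlgCl p),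
            Valued.v (Q.val 0 0) ≤ Valued.v (Q.val 1 0) ∧
            ∀ σ, (Q⁻¹ * r.toLocal v σ * Q).val 1 0 = 0 ∧
              (σ ∈ Literature.NumberTheory.GaloisRepresentations.absInertia (v.adicCompletion F) →
                (Q⁻¹ * r.toLocal v σ * Q).val 1 1 ^ m = 1 ∧
                (Q⁻¹ * r.toLocal v σ * Q).val 0 0 ^ m =
                  algebraMap (Padic p) (PadicAlgCl p)
                    (((Literature.NumberTheory.GaloisRepresentations.GaloisRep.cyclotomicCharacter (v.adicCompletion F) p σ).val : PadicInt p) :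
                      Padic p) ^ ((k' - 1) * m))) ∧
        S.Finite ∧ (∀ v : IsDedekindDomain.HeightOneSpectrum (NumberField.RingOfIntegers F), (p : NumberField.RingOfIntegers F) ∈ v.asIdeal → v ∈ S) ∧
        (∀ v ∉ S, r.IsUnramifiedAt v) ∧
        (∀ v : IsDedekindDomain.HeightOneSpectrum (NumberField.RingOfIntegers F), v ≠ q → (p : NumberField.RingOfIntegers F) ∉ v.asIdeal →
          (∀ 𝔓 ∈ v.primesAbove, ∀ σ ∈ 𝔓.inertia (Field.absoluteGaloisGroup F),
            ((ρ₀ σ).val 0 0 - 1 : O) ∈ IsLocalRing.maximalIdeal O ∧ ((ρ₀ σ).val 1 1 - 1 : O) ∈ IsLocalRing.maximalIdeal O) →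
          v ∉ S) ) :=
  Iff.rfl

theorem stub_quadraticBaseChangeTwist_iff :
    S.stub_quadraticBaseChangeTwist ↔ (
    ∀ (F : Type) [Field F] [NumberField F], NumberField.IsTotallyComplex F → Module.finrank ℚ F = 2 →
      ∀ (p : ℕ) [Fact p.Prime] (hcptQ : Literature.NumberTheory.Automorphic.isCompact_glFiniteIntegralLevel 2 ℚ) (ι : PadicAlgCl p ≃+* ℂ)
        (π : Literature.NumberTheory.Automorphic.CuspidalAutomorphicRepData 2 ℚ hcptQ) (T : Literature.NumberTheory.Automorphic.InfinityType ℚ 2),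
      π.1.HasInfinityType T → T.IsLAlgebraic → T.IsRegular →
      ∀ (ρ' : Literature.NumberTheory.GaloisRepresentations.FramedGaloisRep ℚ (PadicAlgCl p) 2),
      (∀ᶠ w in Filter.cofinite, Summit.Langlands.SatakeFrobCompatibleAt ι π.1 ρ' w) →
      ∀ (ν : Field.absoluteGaloisGroup F →ₜ* (PadicAlgCl p)ˣ), (∃ n : ℕ, 0 < n ∧ ∀ σ, ν σ ^ n = 1) →
      ∀ (r : Literature.NumberTheory.GaloisRepresentations.FramedGaloisRep F (PadicAlgCl p) 2),
      (∀ σ, (r σ).val = ((ν σ : (PadicAlgCl p)ˣ) : PadicAlgCl p) • (ρ' (Literature.NumberTheory.GaloisRepresentations.absGaloisRestrict ℚ F σ)).val) →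
      r.toGaloisRep.IsIrreducible →
      ∀ (S : Set (IsDedekindDomain.HeightOneSpectrum (NumberField.RingOfIntegers F))), S.Finite →
      (∀ v : IsDedekindDomain.HeightOneSpectrum (NumberField.RingOfIntegers F), (p : NumberField.RingOfIntegers F) ∈ v.asIdeal → v ∈ S) →
      (∀ v ∉ S, r.IsUnramifiedAt v) →
      ∀ hcptF : Literature.NumberTheory.Automorphic.isCompact_glFiniteIntegralLevel 2 F,
        ∃ (πF : Literature.NumberTheory.Automorphic.CuspidalAutomorphicRepData 2 F hcptF) (T' : Literature.NumberTheory.Automorphic.InfinityType F 2),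
          πF.1.HasInfinityType T' ∧ T'.IsLAlgebraic ∧ T'.IsRegular ∧
          ∀ v ∉ S, Summit.Langlands.SatakeFrobCompatibleAt ι πF.1 r v ) :=
  Iff.rfl

theorem stub_cuspidalCohomologicalPoint_iff :
    S.stub_cuspidalCohomologicalPoint ↔ (
    ∀ (F : Type) [Field F] [NumberField F], NumberField.IsTotallyComplex F → Module.finrank ℚ F = 2 →
      ∀ (p : ℕ) [Fact p.Prime] (hcpt : Literature.NumberTheory.Automorphic.isCompact_glFiniteIntegralLevel 2 F) (ι : PadicAlgCl p ≃+* ℂ)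
        (πF : Literature.NumberTheory.Automorphic.CuspidalAutomorphicRepData 2 F hcpt) (T : Literature.NumberTheory.Automorphic.InfinityType F 2),
      πF.1.HasInfinityType T → T.IsLAlgebraic → T.IsRegular →
      ∀ (S : Set (IsDedekindDomain.HeightOneSpectrum (NumberField.RingOfIntegers F))), S.Finite →
      (∀ v : IsDedekindDomain.HeightOneSpectrum (NumberField.RingOfIntegers F), (p : NumberField.RingOfIntegers F) ∈ v.asIdeal → v ∈ S) →
      ∀ (r : Literature.NumberTheory.GaloisRepresentations.FramedGaloisRep F (PadicAlgCl p) 2),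
      (∀ v ∉ S, Summit.Langlands.SatakeFrobCompatibleAt ι πF.1 r v) →
      ∃ 𝒰 : Literature.NumberTheory.Automorphic.BigHeckeGLn.TameLevel 2 F p, 𝒰.bad = S ∧ 𝒰.IsPadicallyAutomorphic r ) :=
  Iff.rfl

theorem stub_complementRegimeSeed_iff :
    S.stub_complementRegimeSeed ↔ (
    ∀ (F : Type) [Field F] [NumberField F], NumberField.IsTotallyComplex F → Module.finrank ℚ F = 2 →
      ∀ (p : ℕ) [Fact p.Prime], p ≠ 2 → ∀ (O : ValuationSubring (PadicAlgCl p)),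
      O = (Valued.v : Valuation (PadicAlgCl p) NNReal).valuationSubring →
      ∀ (ρ : Literature.NumberTheory.GaloisRepresentations.FramedGaloisRep F (PadicAlgCl p) 2)
        (ρ₀ : Field.absoluteGaloisGroup F →* Matrix.GeneralLinearGroup (Fin 2) O),
      ρ.toGaloisRep.IsIrreducible → (∀ᶠ v in Filter.cofinite, ρ.IsUnramifiedAt v) →
      ρ.HasUpperTriangularIntegralModel ρ₀ →
      (∃ k : ℕ, 2 ≤ k ∧ ∃ m : ℕ, 0 < m ∧ ∀ v : IsDedekindDomain.HeightOneSpectrum (NumberField.RingOfIntegers F), (p : NumberField.RingOfIntegers F) ∈ v.asIdeal →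
        Literature.NumberTheory.GaloisRepresentations.IsPDistinguishedAt ρ₀ v ∧ ∃ Q : Matrix.GeneralLinearGroup (Fin 2) (PadicAlgCl p),
          Valued.v (Q.val 0 0) ≤ Valued.v (Q.val 1 0) ∧
          ∀ σ, (Q⁻¹ * ρ.toLocal v σ * Q).val 1 0 = 0 ∧
            (σ ∈ Literature.NumberTheory.GaloisRepresentations.absInertia (v.adicCompletion F) →
              (Q⁻¹ * ρ.toLocal v σ * Q).val 1 1 ^ m = 1 ∧
              (Q⁻¹ * ρ.toLocal v σ * Q).val 0 0 ^ m =
                algebraMap (Padic p) (PadicAlgCl p)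
                  (((Literature.NumberTheory.GaloisRepresentations.GaloisRep.cyclotomicCharacter (v.adicCompletion F) p σ).val : PadicInt p) :
                    Padic p) ^ ((k - 1) * m))) →
      ¬ (5 ≤ p ∧ ∃ η : Field.absoluteGaloisGroup ℚ →ₜ* (PadicAlgCl p)ˣ,
      (∀ τ, Valued.v ((η τ : (PadicAlgCl p)ˣ) : PadicAlgCl p) = 1) ∧
      (∀ σ : Field.absoluteGaloisGroup F,
        Valued.v (((η (Literature.NumberTheory.GaloisRepresentations.absGaloisRestrict ℚ F σ) : (PadicAlgCl p)ˣ) : PadicAlgCl p) *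
            ((ρ₀ σ).val 0 0 : PadicAlgCl p) - ((ρ₀ σ).val 1 1 : PadicAlgCl p)) < 1) ∧
      (∀ c : Field.absoluteGaloisGroup ℚ, Literature.NumberTheory.GaloisRepresentations.IsComplexConjugation (Rat.castHom ℝ) c →
        Valued.v (((η c : (PadicAlgCl p)ˣ) : PadicAlgCl p) + 1) < 1) ∧
      (∀ w : IsDedekindDomain.HeightOneSpectrum (NumberField.RingOfIntegers ℚ), (p : NumberField.RingOfIntegers ℚ) ∈ w.asIdeal → ∀ 𝔓 ∈ w.primesAbove,
        (∃ σ ∈ 𝔓.inertia (Field.absoluteGaloisGroup ℚ),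
          ¬ Valued.v (((η σ : (PadicAlgCl p)ˣ) : PadicAlgCl p) - 1) < 1) ∧
        (∃ σ ∈ 𝔓.inertia (Field.absoluteGaloisGroup ℚ),
          ¬ Valued.v (((η σ : (PadicAlgCl p)ˣ) : PadicAlgCl p) * (algebraMap (Padic p) (PadicAlgCl p) (((Literature.NumberTheory.GaloisRepresentations.GaloisRep.cyclotomicCharacter ℚ p σ).val : PadicInt p) : Padic p)) - 1) < 1)) ∧
      ¬ ((∀ τ, Valued.v (((η τ : (PadicAlgCl p)ˣ) : PadicAlgCl p) - (algebraMap (Padic p) (PadicAlgCl p) (((Literature.NumberTheory.GaloisRepresentations.GaloisRep.cyclotomicCharacter ℚ p τ).val : PadicInt p) : Padic p))) < 1) ∧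
          p % 4 = 3 ∧ ∃ x : F, x ^ 2 = -(p : F))) →
      ∃ (𝒰 : Literature.NumberTheory.Automorphic.BigHeckeGLn.TameLevel 2 F p) (r : Literature.NumberTheory.GaloisRepresentations.FramedGaloisRep F (PadicAlgCl p) 2)
        (r₀ : Field.absoluteGaloisGroup F →* Matrix.GeneralLinearGroup (Fin 2) O)
        (q : IsDedekindDomain.HeightOneSpectrum (NumberField.RingOfIntegers F)),
        r.toGaloisRep.IsIrreducible ∧ 𝒰.IsPadicallyAutomorphic r ∧
        r.HasUpperTriangularIntegralModel r₀ ∧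
        (∀ g, ((r₀ g).val 0 0 - (ρ₀ g).val 0 0 : O) ∈ IsLocalRing.maximalIdeal O ∧
          ((r₀ g).val 1 1 - (ρ₀ g).val 1 1 : O) ∈ IsLocalRing.maximalIdeal O) ∧
        (∃ k : ℕ, 2 ≤ k ∧ ∃ m : ℕ, 0 < m ∧ ∀ v : IsDedekindDomain.HeightOneSpectrum (NumberField.RingOfIntegers F), (p : NumberField.RingOfIntegers F) ∈ v.asIdeal →
          ∃ Q : Matrix.GeneralLinearGroup (Fin 2) (PadicAlgCl p),
            Valued.v (Q.val 0 0) ≤ Valued.v (Q.val 1 0) ∧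
            ∀ σ, (Q⁻¹ * r.toLocal v σ * Q).val 1 0 = 0 ∧
              (σ ∈ Literature.NumberTheory.GaloisRepresentations.absInertia (v.adicCompletion F) →
                (Q⁻¹ * r.toLocal v σ * Q).val 1 1 ^ m = 1 ∧
                (Q⁻¹ * r.toLocal v σ * Q).val 0 0 ^ m =
                  algebraMap (Padic p) (PadicAlgCl p)
                    (((Literature.NumberTheory.GaloisRepresentations.GaloisRep.cyclotomicCharacter (v.adicCompletion F) p σ).val : PadicInt p) :
                      Padic p) ^ ((k - 1) * m))) ∧
        (∀ v : IsDedekindDomain.HeightOneSpectrum (NumberField.RingOfIntegers F), v ≠ q → (p : NumberField.RingOfIntegers F) ∉ v.asIdeal →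
          (∀ 𝔓 ∈ v.primesAbove, ∀ σ ∈ 𝔓.inertia (Field.absoluteGaloisGroup F),
            ((ρ₀ σ).val 0 0 - 1 : O) ∈ IsLocalRing.maximalIdeal O ∧ ((ρ₀ σ).val 1 1 - 1 : O) ∈ IsLocalRing.maximalIdeal O) →
          v ∉ 𝒰.bad) ) :=
  Iff.rfl

/-- **The BM range needs no hypothesis on `ρ` beyond `(hunr, hmod, p-distinguishedness)`** (Disproof §3
`crux_of_pairSeed`: irreducibility, ordinarity, orientation and the weight of `ρ` enter the crux only by restricting
which residual pairs occur).  From STUBS 1–5: for `F` imaginary quadratic, `p` prime, `O = 𝒪_{ℚ̄_p}` and ANY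
continuous `ρ` with a residually upper-triangular integral model `ρ₀`, unramified a.e. and `p`-distinguished at
`v ∣ p`, if the residual pair is in the BM range then the crux's conclusion holds for `ρ₀`. -/
theorem seed_of_inBMRange (h₁ : S.stub_inertBMPrimeSupply) (h₂ : S.stub_levelRaisedEisensteinNewformQ)
    (h₃ : S.stub_restrictTwistGaloisPackage) (h₄ : S.stub_quadraticBaseChangeTwist)
    (h₅ : S.stub_cuspidalCohomologicalPoint)
    (F : Type) [Field F] [NumberField F] (hF : IsTotallyComplex F) (hdeg : Module.finrank ℚ F = 2)
    (p : ℕ) [Fact p.Prime] (O : ValuationSubring (PadicAlgCl p))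
    (hO : O = (Valued.v : Valuation (PadicAlgCl p) NNReal).valuationSubring)
    (ρ : FramedGaloisRep F (PadicAlgCl p) 2) (ρ₀ : absoluteGaloisGroup F →* Matrix.GeneralLinearGroup (Fin 2) O)
    (hunr : ∀ᶠ v in cofinite, ρ.IsUnramifiedAt v) (hmod : ρ.HasUpperTriangularIntegralModel ρ₀)
    (hdist : ∀ v : HeightOneSpectrum (𝓞 F), (p : 𝓞 F) ∈ v.asIdeal → IsPDistinguishedAt ρ₀ v)
    (hP : InBMRange F p O ρ₀) :
    ∃ (𝒰 : TameLevel 2 F p) (r : FramedGaloisRep F (PadicAlgCl p) 2)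
      (r₀ : absoluteGaloisGroup F →* Matrix.GeneralLinearGroup (Fin 2) O)
      (q : HeightOneSpectrum (𝓞 F)),
      r.toGaloisRep.IsIrreducible ∧ 𝒰.IsPadicallyAutomorphic r ∧
      r.HasUpperTriangularIntegralModel r₀ ∧
      (∀ g, ((r₀ g).val 0 0 - (ρ₀ g).val 0 0 : O) ∈ maximalIdeal O ∧
        ((r₀ g).val 1 1 - (ρ₀ g).val 1 1 : O) ∈ maximalIdeal O) ∧
      (∃ k : ℕ, 2 ≤ k ∧ ∃ m : ℕ, 0 < m ∧ ∀ v : HeightOneSpectrum (𝓞 F), (p : 𝓞 F) ∈ v.asIdeal →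
        ∃ Q : Matrix.GeneralLinearGroup (Fin 2) (PadicAlgCl p),
          Valued.v (Q.val 0 0) ≤ Valued.v (Q.val 1 0) ∧
          ∀ σ, (Q⁻¹ * r.toLocal v σ * Q).val 1 0 = 0 ∧
            (σ ∈ absInertia (v.adicCompletion F) →
              (Q⁻¹ * r.toLocal v σ * Q).val 1 1 ^ m = 1 ∧
              (Q⁻¹ * r.toLocal v σ * Q).val 0 0 ^ m =
                algebraMap (Padic p) (PadicAlgCl p)
                  (((GaloisRep.cyclotomicCharacter (v.adicCompletion F) p σ).val : PadicInt p) :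
                    Padic p) ^ ((k - 1) * m))) ∧
      (∀ v : HeightOneSpectrum (𝓞 F), v ≠ q → (p : 𝓞 F) ∉ v.asIdeal →
        (∀ 𝔓 ∈ v.primesAbove, ∀ σ ∈ 𝔓.inertia (absoluteGaloisGroup F),
          ((ρ₀ σ).val 0 0 - 1 : O) ∈ maximalIdeal O ∧ ((ρ₀ σ).val 1 1 - 1 : O) ∈ maximalIdeal O) →
        v ∉ 𝒰.bad) := by
  obtain ⟨hp5, η, hU, hD, hodd, hW, hcorner⟩ := hP
  -- stub 1: an inert Billerey–Menares prime `M`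
  obtain ⟨M, hMp, hMne, hMinert, hMunr, hMcong, hMazur⟩ := h₁ F hF hdeg p hp5 η hU hodd hcorner
  -- stub 2: the level-raised Eisenstein-congruent ordinary newform over `ℚ` and its Galois package
  obtain ⟨k, ρ', ρ'₀, hk, hirr', hmod', hdiag', hord', hlev', hmodular⟩ :=
    h₂ p hp5 O hO η M hU hodd hW hMp hMne hMunr hMcong hMazur
  -- stub 3: restrict to `Γ_F`, twist by the Teichmüller lift of `χ̄_a`, frames, level set `S`, the place `q`
  obtain ⟨r, r₀, ν, q, S, hν, hrν, hrirr, hrmod, hrdiag, hrord, hSfin, hSp, hSunr, hSlev⟩ :=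
    h₃ F hF hdeg p O hO ρ ρ₀ hunr hmod hdist η M k ρ' ρ'₀ hU hD hMp hMinert hk hirr' hmod' hdiag' hord' hlev'
  -- stub 2's modularity clause over `ℚ`, then stub 4: quadratic base change + twist
  obtain ⟨ι, π, T, hT, hTL, hTR, hcompat⟩ := hmodular (isCompact_glFiniteIntegralLevel_holds 2 ℚ)
  obtain ⟨πF, T', hT', hT'L, hT'R, hcompatF⟩ :=
    h₄ F hF hdeg p (isCompact_glFiniteIntegralLevel_holds 2 ℚ) ι π T hT hTL hTR ρ' hcompat ν hν r hrν hrirr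
      S hSfin hSp hSunr (isCompact_glFiniteIntegralLevel_holds 2 F)
  -- stub 5: the dictionary — a continuous `ℚ̄_p`-point of `𝕋(𝒰)`, `𝒰.bad = S`
  obtain ⟨𝒰, hbad, hpa⟩ :=
    h₅ F hF hdeg p (isCompact_glFiniteIntegralLevel_holds 2 F) ι πF T' hT' hT'L hT'R S hSfin hSp r hcompatF
  exact ⟨𝒰, r, r₀, q, hrirr, hpa, hrmod, hrdiag, hrord, fun v hvq hvp hur => hbad ▸ hSlev v hvq hvp hur⟩

/-! ## 4. The composition: the six stubs imply the crux, BY NAME (kernel-checked, no `sorry` of its own) -/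

/-- **The line concludes the crux.**  Case split on `InBMRange F p O ρ₀`: inside, `seed_of_inBMRange` (STUBS 1–5;
the crux's `hirr` and its ordinary/oriented local clause are NOT consumed beyond `p`-distinguishedness); outside,
STUB 6 (conceded) is the crux verbatim on the complement. -/
theorem EisensteinProModularSeed_of (h₁ : S.stub_inertBMPrimeSupply)
    (h₂ : S.stub_levelRaisedEisensteinNewformQ) (h₃ : S.stub_restrictTwistGaloisPackage)
    (h₄ : S.stub_quadraticBaseChangeTwist) (h₅ : S.stub_cuspidalCohomologicalPoint)
    (h₆ : S.stub_complementRegimeSeed) :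
    Summit.Langlands.Langlands.Theses.SkinnerWilesDefectOne.EisensteinProModularSeed := by
  intro F _ _ hF hdeg p _ hp O hO ρ ρ₀ hirr hunr hmod hloc
  by_cases hP : InBMRange F p O ρ₀
  · have hdist : ∀ v : HeightOneSpectrum (𝓞 F), (p : 𝓞 F) ∈ v.asIdeal → IsPDistinguishedAt ρ₀ v := by
      obtain ⟨k₀, -, m₀, -, hloc'⟩ := hloc
      exact fun v hv => (hloc' v hv).1
    exact seed_of_inBMRange h₁ h₂ h₃ h₄ h₅ F hF hdeg p O hO ρ ρ₀ hunr hmod hdist hP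
  · exact h₆ F hF hdeg p hp O hO ρ ρ₀ hirr hunr hmod hloc hP

/-- **The skeleton**: the crux modulo exactly the six registered stubs (sorries live only inside `stub_*`). -/
theorem EisensteinProModularSeed_proof :
    Summit.Langlands.Langlands.Theses.SkinnerWilesDefectOne.EisensteinProModularSeed :=
  EisensteinProModularSeed_of stub_inertBMPrimeSupply stub_levelRaisedEisensteinNewformQ
    stub_restrictTwistGaloisPackage stub_quadraticBaseChangeTwist stub_cuspidalCohomologicalPoint
    stub_complementRegimeSeed

end Summit.Langlands.Langlands.Cruxes.EisensteinProModularSeed.DescendRaiseBasechange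

end
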